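import Literature.NumberTheory.EllipticCurves.BhargavaShankarCounting
import Literature.NumberTheory.EllipticCurves.BinaryQuarticFormsProofs
import Literature.NumberTheory.EllipticCurves.BSDSelmer
import Literature.NumberTheory.EllipticCurves.BSDWave0Proofs
import Literature.NumberTheory.EllipticCurves.SelmerFiniteProofs
import Mathlib.Analysis.PSeries
import Mathlib.Analysis.SpecialFunctions.Log.Summable
import Mathlib.NumberTheory.PrimeCounting
import Mathlib.NumberTheory.SumPrimeReciprocals
import Mathlib.RingTheory.Polynomial.RationalRoot
import Mathlib.NumberTheory.Padics.RingHoms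
import Mathlib.GroupTheory.Index
import Mathlib.Algebra.Module.Torsion.Basic
import HarnessLib

/-!
# Bhargava–Shankar, Theorem 1.1 assembled from its printed counting inputs; Lemma 5.15 and
# Prop. 5.7 proved; the identity class of the `2`-Selmer parametrization

`Proofs` companion of `Literature/NumberTheory/EllipticCurves/BhargavaShankarCounting.lean` (named
facts of the second decomposition layer of `Literature.NumberTheory.EllipticCurves.averageRankLE_three_halves`). Source and
numbering: M. Bhargava, A. Shankar, *Binary quartic forms having bounded invariants, and the
boundedness of the average rank of elliptic curves*, Ann. of Math. (2) 181 (2015) 191–242; theorem,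
equation and page numbers are those of the held arXiv text `arXiv:1006.1002v2` (its §5).

## Main results (all sorry-free)

* `Literature.NumberTheory.EllipticCurves.card_heightFamilyBelow_asymptotic_holds` — **Lemma 5.15 for the family of all curves,
  proved**: `#{E_{A,B} : H < X} / X^{5/6} → c_F = (4/(4^{1/3}27^{1/2}))·∏_p(1 − p⁻¹⁰)`
  (`heightFamilyConstant`). Proof (namespace `Literature.HeightCount`): the pairs `(A,B)` with
  `4|A|³ < X`, `27B² < X` form a box of side counts `2R₁ + O(1)`, `2R₂ + O(1)`,
  `R₁ = (X/4)^{1/3}`, `R₂ = (X/27)^{1/2}`; inclusion–exclusion over the primes `≤ Y`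
  (`card_filter_minimalLE`, via `Finset.prod_add`) counts the pairs with no `p ≤ Y`, `p⁴ ∣ A`,
  `p⁶ ∣ B` as `4R₁R₂∏_{p ≤ Y}(1 − p⁻¹⁰) + O_Y(R₁ + R₂ + 1)`; the pairs failing minimality only at a
  prime `p > Y` are `≤ 8R₁R₂/(Y+1) + 2R₁ + 2R₂` (`card_filter_exists_dvdCond_le`, using
  `Σ_{n > Y} n⁻² ≤ 2/(Y+1)`), the degenerate pairs `4A³ + 27B² = 0` are `≤ 2R₂ + 1`; then
  `X → ∞`, `Y → ∞`, with `∏_{p ≤ Y}(1 − p⁻¹⁰) → ∏_p (1 − p⁻¹⁰)`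
  (`multipliable_one_add_of_summable`).
* `Literature.NumberTheory.EllipticCurves.hasRationalTwoTorsion_iff` — the printed criterion (p. 32): `x³ + Ax + B` has a rational
  root iff `E_{A,B}(ℚ)` has a point `P ≠ O` with `2P = O` (proved: `2P = O ⇔ P = −P ⇔ y(P) = 0`).
* `Literature.NumberTheory.EllipticCurves.card_filter_hasRationalTwoTorsion_le` — **Prop. 5.7, proved** (with `O(X^{1/2})` in place
  of the printed `O(X^{1/2+ε})`): at most `15 X^{1/2}` curves `E_{A,B}` of height `< X` have
  `x³ + Ax + B` with a rational root (the root is an integer `r`, `|r| ≤ 2X^{1/6}`, and `(A, r)`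
  determines `B`).
* `Literature.NumberTheory.EllipticCurves.BinaryQuartic.pgl2QClassCount_eq_succ` — **the identity class** (held text p. 33: for `E`
  without rational `2`-torsion the non-identity elements of `S₂(E)` correspond to the classes of
  *irreducible* locally soluble quartics): for `4A³ + 27B² ≠ 0` and `x³ + Ax + B` without rational
  root, the `PGL₂(ℚ)`-classes of locally soluble integral quartics with invariants
  `(2⁴·(−3A), 2⁶·(−27B))` are those of the irreducible ones plus exactly one more, the class of
  `4x³y + 4Axy³ + 4By⁴`. Ingredients: a reducible such form has a rational linear factor
  (`exists_eval_eq_zero_of_not_isIrreducible`: a factorization into two rational quadratics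
  `a(x²+qx+r)(x²+tx+u)` would make `−φ/12`, `φ = a(2(r+u) − qt)`, a rational root of
  `x³ + Ax + B`, by the resolvent identity `φ³ − 3Iφ + J = 0`, `resolvent_identity`); a form with
  a rational linear factor is `PGL₂(ℚ)`-equivalent to `4x³y + 4Axy³ + 4By⁴`
  (`pgl2Equiv_identityQuartic_of_eval_eq_zero`, the normalisation of the proof of Prop. 2.8 run
  over `ℚ`); zeros in `ℙ¹(ℚ)` transport along equivalences (`PGL2Equiv.exists_eval_eq_zero`).
* `Literature.NumberTheory.EllipticCurves.brumerKramer_card_quotient_two_of_AEC` — **Lemma 5.16 (Brumer–Kramer) derived from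
  Silverman AEC Prop. VII.6.3** (`exists_finiteIndex_addEquiv_padicInt`: `E(ℚ_p)` has a finite-index
  subgroup `A ≅ ℤ_p`): the index identity `[G : 2G]·#(A ∩ G[2]) = [A : 2A]·#G[2]`
  (`index_range_zsmul_mul_card`, from `AddSubgroup.index_map` and `relIndex` bookkeeping) with
  `[ℤ_p : 2ℤ_p] = 2` for `p = 2` (via `PadicInt.toZMod`), `= 1` for odd `p` (`2 ∈ ℤ_pˣ`), and
  `ℤ_p[2] = 0`.
* `Literature.NumberTheory.EllipticCurves.average_card_selmerTwo_of_facts` — **Theorem 1.1 assembled** (§5.4): granted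
  Lemma 5.15 (hypothesis; discharged in `…_of_BS_facts`), eq. (31) evaluated by Prop. 5.12 and
  Lemma 5.16 (`bhargavaShankar_sum_irredClassCount_asymptotic`), Theorem 5.6
  (`bhargavaShankar_card_selmerTwo_eq`) and Prop. 5.8
  (`bhargavaShankar_sum_card_selmerTwo_twoTorsion_le`), the average of `#S₂(E)` tends to `3`
  (`Literature.NumberTheory.EllipticCurves.average_card_selmerTwo`); and `Literature.NumberTheory.EllipticCurves.averageRankLE_three_halves_of_BS_facts`:
  **Cor. 1.2 (`averageRankLE_three_halves`) granted exactly the three deep printed inputs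
  Thm 5.6, eq. (31) and Prop. 5.8**, everything else (Cor. 1.2 from Thm 1.1, AEC X.4.2(b),
  Lemma 5.15, Prop. 5.7, the identity class, the bookkeeping of §5.4) being proved in the tree.

## Design

* Theorems plus a handful of counting helpers (`Literature.NumberTheory.EllipticCurves.HeightCount.intBall`, `R₁`, `R₂`, `box`,
  `DvdCond`, `MinimalLE`: finite sets and predicates used only in the proof of Lemma 5.15; the
  primes `≤ Y` are Mathlib's `Nat.primesLE`); no statement file is touched. `noncomputable
  section`, `open scoped Classical` as in
  the files served. Dot-notation extensions live in `namespace Literature.BinaryQuartic` (the tree's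
  namespace of binary quartic forms).

## References

* M. Bhargava, A. Shankar, Ann. of Math. (2) 181 (2015) 191–242 = arXiv:1006.1002: Thm 1.1,
  Cor. 1.2, Prop. 2.8, §5.1 (Thm 5.6, Props. 5.7–5.9), §5.4 (Thm 5.14, Lemma 5.15, eq. (31),
  Lemma 5.16). [cite: BhargavaShankarAnnals2015, §5.4 (arXiv:1006.1002v2 numbering)]
* J. H. Silverman, *The Arithmetic of Elliptic Curves*, 2nd ed. (2009), Thm X.4.2(b).
  [cite: SilvermanAEC2009, Thm X.4.2]
-/

noncomputable section

open scoped Classical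
open Filter Topology Polynomial

namespace Literature.NumberTheory.EllipticCurves

/-! ## §0 An elementary limit -/

/-- `O(X^a)` with `a < 5/6` is `o(X^{5/6})` (elementary). [folklore] -/
theorem tendsto_div_rpow_fiveSixths_of_le {u : ℕ → ℝ} {C a : ℝ} (ha : a < 5 / 6)
    (h0 : ∀ X, 0 ≤ u X) (hle : ∀ X : ℕ, 1 ≤ X → u X ≤ C * (X : ℝ) ^ a) :
    Tendsto (fun X : ℕ ↦ u X / (X : ℝ) ^ (5 / 6 : ℝ)) atTop (𝓝 0) := by
  have hlim : Tendsto (fun X : ℕ ↦ C * (X : ℝ) ^ (a - 5 / 6)) atTop (𝓝 0) := by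
    have h1 := (tendsto_rpow_neg_atTop (by linarith : 0 < 5 / 6 - a)).comp
      tendsto_natCast_atTop_atTop
    have h2 := h1.const_mul C
    rw [mul_zero] at h2
    refine h2.congr' (Eventually.of_forall fun X ↦ ?_)
    simp only [Function.comp_apply, neg_sub]
  refine tendsto_of_tendsto_of_tendsto_of_le_of_le' tendsto_const_nhds hlim
    (Eventually.of_forall fun X ↦ div_nonneg (h0 X) (by positivity)) ?_
  filter_upwards [eventually_ge_atTop 1] with X hX
  have hX0 : (0 : ℝ) < X := by exact_mod_cast hX
  rw [div_le_iff₀ (by positivity), mul_assoc, ← Real.rpow_add hX0, sub_add_cancel]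
  exact hle X hX

namespace BinaryQuartic

/-! ## §1 The dehomogenised polynomial `f(x,1)` -/

section ToPoly

variable {R : Type*} [CommRing R]

/-- `f(x,1)` evaluated at `x` is `f.eval x 1`. [folklore] -/
theorem eval_toPoly (f : BinaryQuartic R) (x : R) : f.toPoly.eval x = f.eval x 1 := by
  simp [toPoly, eval]

/-- Coefficients of `f(x,1)`. [folklore] -/
theorem coeff_toPoly (f : BinaryQuartic R) (n : ℕ) :
    f.toPoly.coeff n = if n = 4 then f.a else if n = 3 then f.b else if n = 2 then f.c
      else if n = 1 then f.d else if n = 0 then f.e else 0 := by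
  simp only [toPoly, coeff_add, coeff_C_mul, coeff_X_pow, coeff_X, coeff_C]
  rcases n with _ | _ | _ | _ | _ | n <;> simp

/-- `toPoly` is injective: a binary quartic form is determined by `f(x,1)`. [folklore] -/
theorem toPoly_injective : Function.Injective (toPoly : BinaryQuartic R → R[X]) := by
  intro f g h
  have hc : ∀ n, f.toPoly.coeff n = g.toPoly.coeff n := fun n ↦ by rw [h]
  have h4 := hc 4; have h3 := hc 3; have h2 := hc 2; have h1 := hc 1; have h0 := hc 0
  simp only [coeff_toPoly] at h4 h3 h2 h1 h0
  norm_num at h4 h3 h2 h1 h0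
  ext <;> assumption

/-- `deg f(x,1) ≤ 4`. [folklore] -/
theorem natDegree_toPoly_le (f : BinaryQuartic R) : f.toPoly.natDegree ≤ 4 := by
  rw [Polynomial.natDegree_le_iff_coeff_eq_zero]
  intro n hn
  rw [coeff_toPoly]
  have h4 : n ≠ 4 := by omega
  have h3 : n ≠ 3 := by omega
  have h2 : n ≠ 2 := by omega
  have h1 : n ≠ 1 := by omega
  have h0 : n ≠ 0 := by omega
  simp [h4, h3, h2, h1, h0]

/-- For `a ≠ 0`, `deg f(x,1) = 4`. [folklore] -/
theorem natDegree_toPoly {f : BinaryQuartic R} (ha : f.a ≠ 0) : f.toPoly.natDegree = 4 := by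
  refine le_antisymm (natDegree_toPoly_le f) ?_
  refine Polynomial.le_natDegree_of_ne_zero ?_
  rw [coeff_toPoly]; simpa using ha

/-- For `a ≠ 0`, the leading coefficient of `f(x,1)` is `a`. [folklore] -/
theorem leadingCoeff_toPoly {f : BinaryQuartic R} (ha : f.a ≠ 0) : f.toPoly.leadingCoeff = f.a := by
  rw [Polynomial.leadingCoeff, natDegree_toPoly ha, coeff_toPoly]; simp

/-- For `a ≠ 0`, `f(x,1) ≠ 0`. [folklore] -/
theorem toPoly_ne_zero {f : BinaryQuartic R} (ha : f.a ≠ 0) : f.toPoly ≠ 0 := by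
  intro h
  have := natDegree_toPoly ha
  rw [h, natDegree_zero] at this
  exact absurd this (by norm_num)

/-- Homogeneity: `f(tx, ty) = t⁴ f(x,y)`. [folklore] -/
theorem eval_mul_mul (f : BinaryQuartic R) (t x y : R) :
    f.eval (t * x) (t * y) = t ^ 4 * f.eval x y := by
  simp only [eval]; ring

/-- `f(x, 0) = a x⁴`. [folklore] -/
theorem eval_zero_right (f : BinaryQuartic R) (x : R) : f.eval x 0 = f.a * x ^ 4 := by
  simp [eval]

end ToPoly

/-! ## §2 Rational zeros of a form versus roots of `f(x,1)` and irreducibility -/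

section Roots

variable {K : Type*} [Field K]

/-- A zero `(x, y)` with `y ≠ 0` of the form gives the root `x/y` of `f(x,1)`. [folklore] -/
theorem toPoly_isRoot_of_eval_eq_zero (f : BinaryQuartic K) {x y : K} (hy : y ≠ 0)
    (h : f.eval x y = 0) : f.toPoly.IsRoot (x / y) := by
  rw [Polynomial.IsRoot, eval_toPoly]
  have : f.eval (y⁻¹ * x) (y⁻¹ * y) = 0 := by rw [eval_mul_mul, h, mul_zero]
  rwa [inv_mul_cancel₀ hy, ← div_eq_inv_mul] at this

end Roots

/-- An irreducible integral form has no zero in `ℙ¹(ℚ)`: a zero `(x, 0)` forces `a = 0`, and a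
zero `(x, y)` with `y ≠ 0` gives a rational root of the quartic `f(x,1)`, which is then not
irreducible (elementary). [folklore] -/
theorem IsIrreducible.eval_ne_zero {f : BinaryQuartic ℤ} (hf : f.IsIrreducible) {x y : ℚ}
    (hxy : x ≠ 0 ∨ y ≠ 0) : (f.map (Int.castRingHom ℚ)).eval x y ≠ 0 := by
  intro h
  have ha : (f.map (Int.castRingHom ℚ)).a ≠ 0 := by simpa using hf.1
  by_cases hy : y = 0
  · subst hy
    have hx : x ≠ 0 := hxy.resolve_right (not_not.mpr rfl)
    rw [eval_zero_right] at h
    exact (mul_ne_zero ha (pow_ne_zero 4 hx)) h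
  · have hroot := toPoly_isRoot_of_eval_eq_zero _ hy h
    have hdeg := Polynomial.degree_eq_one_of_irreducible_of_root hf.2 hroot
    have h4 := natDegree_toPoly ha
    rw [Polynomial.degree_eq_natDegree (toPoly_ne_zero ha), h4] at hdeg
    exact absurd hdeg (by decide)

/-! ## §3 Reducible forms attached to a curve without rational `2`-torsion have a rational zero -/

/-- **The resolvent identity.** If `f(x,1) = a (x² + qx + r)(x² + tx + u)` then
`φ = a (2(r + u) − qt)` satisfies `φ³ − 3 I(f) φ + J(f) = 0` (classical: the three splittings of a
quartic into two quadratics give the three roots of the resolvent cubic `φ³ − 3Iφ + J`; cf.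
Bhargava–Shankar, held arXiv text p. 32–33: forms that factor over `ℚ` into two quadratics only
arise from curves with a rational `2`-torsion point). [folklore] -/
theorem resolvent_identity {R : Type*} [CommRing R] (a q r t u : R) :
    let G : BinaryQuartic R :=
      ⟨a, a * (q + t), a * (r + q * t + u), a * (q * u + r * t), a * (r * u)⟩
    (a * (2 * (r + u) - q * t)) ^ 3 - 3 * G.I * (a * (2 * (r + u) - q * t)) + G.J = 0 := by
  simp only [I, J]
  ring

/-- The factored form: `(x² + qx + r)(x² + tx + u) · a = G(x,1)` for the quartic `G` of
`resolvent_identity`. [folklore] -/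
theorem toPoly_factored {R : Type*} [CommRing R] (a q r t u : R) :
    (⟨a, a * (q + t), a * (r + q * t + u), a * (q * u + r * t), a * (r * u)⟩ :
        BinaryQuartic R).toPoly =
      (X ^ 2 + C q * X + C r) * (X ^ 2 + C t * X + C u) * C a := by
  simp only [toPoly, C_mul, C_add]
  ring

/-- **Reducible forms have a rational zero, absent rational `2`-torsion.** Let `f` be an integral
binary quartic form with invariants `I(f) = 2⁴·(−3A)`, `J(f) = 2⁶·(−27B)` such that `x³ + Ax + B`
has no rational root. If `f` is not irreducible then `f` has a zero in `ℙ¹(ℚ)` (i.e. a rational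
linear factor): either `a = 0` (zero `[1:0]`), or `f(x,1)` has a linear factor, or
`f(x,1) = a(x²+qx+r)(x²+tx+u)` over `ℚ` — but then, by `resolvent_identity`, `−φ/12` with
`φ = a(2(r+u) − qt)` is a rational root of `x³ + Ax + B`, excluded (Bhargava–Shankar, held arXiv
text p. 32–33: for curves without rational `2`-torsion the non-identity Selmer classes are the
classes of irreducible locally soluble quartics). [cite: BhargavaShankarAnnals2015, §5.2 p. 33 (first paragraph after Lemma 5.11; arXiv:1006.1002v2 numbering)] -/
theorem exists_eval_eq_zero_of_not_isIrreducible {f : BinaryQuartic ℤ} {A B : ℤ}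
    (hI : f.I = 2 ^ 4 * (-3 * A)) (hJ : f.J = 2 ^ 6 * (-27 * B))
    (hT : ∀ r : ℚ, r ^ 3 + A * r + B ≠ 0) (hf : ¬ f.IsIrreducible) :
    ∃ x y : ℚ, (x ≠ 0 ∨ y ≠ 0) ∧ (f.map (Int.castRingHom ℚ)).eval x y = 0 := by
  set F := f.map (Int.castRingHom ℚ) with hF
  by_cases ha : f.a = 0
  · exact ⟨1, 0, Or.inl one_ne_zero, by simp [eval_zero_right, hF, ha]⟩
  have hirr : ¬ Irreducible F.toPoly := fun h ↦ hf ⟨ha, h⟩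
  have haQ : F.a ≠ 0 := by simpa [hF] using ha
  have hP0 : F.toPoly ≠ 0 := toPoly_ne_zero haQ
  set P₁ := F.toPoly * C (F.toPoly.leadingCoeff)⁻¹ with hP₁
  have hmon : P₁.Monic := Polynomial.monic_mul_leadingCoeff_inv hP0
  have hdeg₁ : P₁.natDegree = 4 := by
    rw [hP₁, Polynomial.natDegree_mul_leadingCoeff_inv _ hP0, natDegree_toPoly haQ]
  have hirr₁ : ¬ Irreducible P₁ := by
    rwa [hP₁, Polynomial.irreducible_mul_leadingCoeff_inv]
  rw [hmon.irreducible_iff_natDegree', not_and_or] at hirr₁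
  rcases hirr₁ with h1 | h2
  · exfalso
    apply h1
    intro hP
    have := congrArg Polynomial.natDegree hP
    rw [hdeg₁, natDegree_one] at this
    exact absurd this (by norm_num)
  push Not at h2
  obtain ⟨g₁, g₂, hg₁, hg₂, hprod, hdeg⟩ := h2
  rw [hdeg₁] at hdeg
  norm_num at hdeg
  -- `P = P₁ · a`, so roots of `P₁` are zeros of `F`
  have hlead : F.toPoly.leadingCoeff = F.a := leadingCoeff_toPoly haQ
  have hPP₁ : F.toPoly = P₁ * C F.a := by
    rw [hP₁, hlead, mul_assoc, ← C_mul, inv_mul_cancel₀ haQ, C_1, mul_one]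
  have root_of : ∀ r : ℚ, P₁.IsRoot r → ∃ x y : ℚ, (x ≠ 0 ∨ y ≠ 0) ∧ F.eval x y = 0 := by
    intro r hr
    refine ⟨r, 1, Or.inr one_ne_zero, ?_⟩
    rw [← eval_toPoly, hPP₁, Polynomial.eval_mul, Polynomial.IsRoot.def.mp hr, zero_mul]
  have hsum : g₁.natDegree + g₂.natDegree = 4 := by
    rw [← hg₁.natDegree_mul hg₂, hprod, hdeg₁]
  rcases hdeg with ⟨h0, h2⟩
  interval_cases h : g₂.natDegree
  · -- linear factor
    have hg₂' := hg₂.eq_X_add_C h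
    apply root_of (-(g₂.coeff 0))
    rw [← hprod, Polynomial.IsRoot, Polynomial.eval_mul, hg₂']
    simp
  · -- two quadratics: excluded by the resolvent
    exfalso
    have h₁ : g₁.natDegree = 2 := by omega
    have e₁ := hg₁.as_sum
    have e₂ := hg₂.as_sum
    rw [h₁] at e₁
    rw [h] at e₂
    simp only [Finset.sum_range_succ, Finset.sum_range_zero, zero_add, pow_zero, mul_one,
      pow_one] at e₁ e₂
    set q := g₁.coeff 1; set r := g₁.coeff 0; set t := g₂.coeff 1; set u := g₂.coeff 0
    set a := F.a with ha'
    have hfact : F.toPoly =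
        (⟨a, a * (q + t), a * (r + q * t + u), a * (q * u + r * t), a * (r * u)⟩ :
          BinaryQuartic ℚ).toPoly := by
      rw [toPoly_factored, hPP₁, ← hprod, e₁, e₂]
      ring
    have hFG := toPoly_injective hfact
    have hIq : F.I = 2 ^ 4 * (-3 * (A : ℚ)) := by
      rw [hF, I_map, hI, eq_intCast]; push_cast; ring
    have hJq : F.J = 2 ^ 6 * (-27 * (B : ℚ)) := by
      rw [hF, J_map, hJ, eq_intCast]; push_cast; ring
    have hres := resolvent_identity a q r t u
    simp only at hres
    rw [← hFG, hIq, hJq] at hres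
    exact hT (-(a * (2 * (r + u) - q * t)) / 12) (by linear_combination (-1 / 1728 : ℚ) * hres)


/-! ## §4 Forms with a rational zero: normal form `4x³y + 4A xy³ + 4B y⁴` -/

section NormalForm

/-- The leading coefficient of `γ · f` is the value of `f` at the first row of `γ`. [folklore] -/
theorem subst_a {R : Type*} [CommRing R] (f : BinaryQuartic R) (γ : Matrix (Fin 2) (Fin 2) R) :
    (f.subst γ).a = f.eval (γ 0 0) (γ 0 1) := by
  simp only [subst, eval]

/-- Step 1: a form over `ℚ` with a zero in `ℙ¹(ℚ)` is `PGL₂(ℚ)`-equivalent to one with `a = 0`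
(move the zero to `[1:0]`; Bhargava–Shankar, held arXiv text, proof of Prop. 2.8).
[cite: BhargavaShankarAnnals2015, Prop. 2.8 (proof; arXiv:1006.1002v2 numbering)] -/
theorem exists_pgl2Equiv_a_eq_zero {F : BinaryQuartic ℚ}
    (h : ∃ x y : ℚ, (x ≠ 0 ∨ y ≠ 0) ∧ F.eval x y = 0) : ∃ G, PGL2Equiv F G ∧ G.a = 0 := by
  obtain ⟨x, y, hxy, h0⟩ := h
  -- a matrix with first row `(x, y)` and nonzero determinant
  have key : ∀ γ : Matrix (Fin 2) (Fin 2) ℚ, γ 0 0 = x → γ 0 1 = y → γ.det ≠ 0 →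
      ∃ G, PGL2Equiv F G ∧ G.a = 0 := by
    intro γ h00 h01 hdet
    refine ⟨(γ.det ^ 2)⁻¹ • F.subst γ, ⟨γ, hdet, rfl⟩, ?_⟩
    simp only [smul_a, subst_a, h00, h01, h0, mul_zero]
  by_cases hx : x = 0
  · have hy : y ≠ 0 := hxy.resolve_left (not_not.mpr hx)
    exact key !![x, y; 1, 0] (by simp) (by simp) (by rw [Matrix.det_fin_two_of]; simpa using hy)
  · exact key !![x, y; 0, 1] (by simp) (by simp) (by rw [Matrix.det_fin_two_of]; simpa using hx)

/-- Step 2: if `a = 0` and `b ≠ 0`, a shear `x ↦ x + ty` kills `c` (keeping `a = 0` and `b`).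
[cite: BhargavaShankarAnnals2015, Prop. 2.8 (proof; arXiv:1006.1002v2 numbering)] -/
theorem exists_pgl2Equiv_c_eq_zero {G : BinaryQuartic ℚ} (ha : G.a = 0) (hb : G.b ≠ 0) :
    ∃ G₂, PGL2Equiv G G₂ ∧ G₂.a = 0 ∧ G₂.b = G.b ∧ G₂.c = 0 := by
  set t : ℚ := -G.c / (3 * G.b) with ht
  have hdet : (!![1, 0; t, 1] : Matrix (Fin 2) (Fin 2) ℚ).det = 1 := by
    rw [Matrix.det_fin_two_of]; ring
  refine ⟨G.subst !![1, 0; t, 1], ⟨!![1, 0; t, 1], by rw [hdet]; exact one_ne_zero, ?_⟩, ?_, ?_, ?_⟩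
  · rw [hdet, one_pow, inv_one, one_smul]
  · simp [subst, ha]
  · simp [subst, ha]
  · simp only [subst, ha, Matrix.of_apply, Matrix.cons_val', Matrix.cons_val_zero,
      Matrix.cons_val_one, Matrix.cons_val_fin_one]
    rw [ht]; field_simp; ring

/-- Step 3: if `a = c = 0` and `b ≠ 0`, the diagonal substitution `x ↦ (4/b)x` (twisted action)
makes `b = 4`. [cite: BhargavaShankarAnnals2015, Prop. 2.8 (proof; arXiv:1006.1002v2 numbering)] -/
theorem exists_pgl2Equiv_b_eq_four {G : BinaryQuartic ℚ} (ha : G.a = 0) (hb : G.b ≠ 0)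
    (hc : G.c = 0) : ∃ G₃, PGL2Equiv G G₃ ∧ G₃.a = 0 ∧ G₃.b = 4 ∧ G₃.c = 0 := by
  set l : ℚ := 4 / G.b with hl
  have hl0 : l ≠ 0 := div_ne_zero four_ne_zero hb
  have hdet : (!![l, 0; 0, 1] : Matrix (Fin 2) (Fin 2) ℚ).det = l := by
    rw [Matrix.det_fin_two_of]; ring
  refine ⟨((!![l, 0; 0, 1] : Matrix (Fin 2) (Fin 2) ℚ).det ^ 2)⁻¹ • G.subst !![l, 0; 0, 1],
    ⟨!![l, 0; 0, 1], by rw [hdet]; exact hl0, rfl⟩, ?_, ?_, ?_⟩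
  · simp [subst, ha]
  · simp only [smul_b, subst, ha, hc, hdet, Matrix.of_apply, Matrix.cons_val', Matrix.cons_val_zero,
      Matrix.cons_val_one, Matrix.cons_val_fin_one]
    rw [hl]; field_simp; ring
  · simp [subst, ha, hc]

/-- Step 4: a form with `a = c = 0`, `b = 4` is determined by its invariants:
`I = −12d`, `J = −432e`. [folklore] -/
theorem eq_identityQuartic_of_invariants {G : BinaryQuartic ℚ} {A B : ℚ} (ha : G.a = 0)
    (hb : G.b = 4) (hc : G.c = 0) (hI : G.I = 2 ^ 4 * (-3 * A)) (hJ : G.J = 2 ^ 6 * (-27 * B)) :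
    G = ⟨0, 4, 0, 4 * A, 4 * B⟩ := by
  simp only [I, ha, hb, hc] at hI
  simp only [J, ha, hb, hc] at hJ
  ext
  · exact ha
  · exact hb
  · exact hc
  · linarith
  · linarith

/-- A form with `a = 0` and nondegenerate invariants `(2⁴·(−3A), 2⁶·(−27B))`, `4A³ + 27B² ≠ 0`,
has `b ≠ 0` (if `a = b = 0` then `I = c²`, `J = −2c³`, `4I³ = J²`). [folklore] -/
theorem b_ne_zero_of_invariants {G : BinaryQuartic ℚ} {A B : ℚ} (ha : G.a = 0)
    (hI : G.I = 2 ^ 4 * (-3 * A)) (hJ : G.J = 2 ^ 6 * (-27 * B)) (hΔ : 4 * A ^ 3 + 27 * B ^ 2 ≠ 0) :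
    G.b ≠ 0 := by
  intro hb
  simp only [I, ha, hb] at hI
  simp only [J, ha, hb] at hJ
  apply hΔ
  have h1 : 4 * G.I ^ 3 - G.J ^ 2 = 0 := by
    simp only [I, J, ha, hb]; ring
  have h2 : 4 * G.I ^ 3 - G.J ^ 2 = -110592 * (4 * A ^ 3 + 27 * B ^ 2) := by
    have eI : G.I = 2 ^ 4 * (-3 * A) := by simp only [I, ha, hb]; linarith
    have eJ : G.J = 2 ^ 6 * (-27 * B) := by simp only [J, ha, hb]; linarith
    rw [eI, eJ]; ring
  have : (-110592 : ℚ) * (4 * A ^ 3 + 27 * B ^ 2) = 0 := by rw [← h2, h1]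
  simpa using this

/-- **Normal form of forms with a rational zero** (Bhargava–Shankar, held arXiv text, proof of
Prop. 2.8, run over `ℚ` with the twisted `PGL₂`-action: send the zero to `[1:0]`, shear, rescale):
a binary quartic form over `ℚ` with invariants `(2⁴·(−3A), 2⁶·(−27B))`, `4A³ + 27B² ≠ 0`, having a
zero in `ℙ¹(ℚ)` is `PGL₂(ℚ)`-equivalent to `4x³y + 4A xy³ + 4B y⁴`.
[cite: BhargavaShankarAnnals2015, Prop. 2.8 (proof; arXiv:1006.1002v2 numbering)] -/
theorem pgl2Equiv_identityQuartic_of_eval_eq_zero {F : BinaryQuartic ℚ} {A B : ℚ}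
    (hI : F.I = 2 ^ 4 * (-3 * A)) (hJ : F.J = 2 ^ 6 * (-27 * B)) (hΔ : 4 * A ^ 3 + 27 * B ^ 2 ≠ 0)
    (h : ∃ x y : ℚ, (x ≠ 0 ∨ y ≠ 0) ∧ F.eval x y = 0) :
    PGL2Equiv F ⟨0, 4, 0, 4 * A, 4 * B⟩ := by
  obtain ⟨G₁, h₁, ha₁⟩ := exists_pgl2Equiv_a_eq_zero h
  have hI₁ : G₁.I = 2 ^ 4 * (-3 * A) := by rw [h₁.I_eq, hI]
  have hJ₁ : G₁.J = 2 ^ 6 * (-27 * B) := by rw [h₁.J_eq, hJ]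
  have hb₁ := b_ne_zero_of_invariants ha₁ hI₁ hJ₁ hΔ
  obtain ⟨G₂, h₂, ha₂, hb₂, hc₂⟩ := exists_pgl2Equiv_c_eq_zero ha₁ hb₁
  obtain ⟨G₃, h₃, ha₃, hb₃, hc₃⟩ := exists_pgl2Equiv_b_eq_four ha₂ (hb₂ ▸ hb₁) hc₂
  have h₁₃ := (h₁.trans h₂).trans h₃
  have hI₃ : G₃.I = 2 ^ 4 * (-3 * A) := by rw [h₁₃.I_eq, hI]
  have hJ₃ : G₃.J = 2 ^ 6 * (-27 * B) := by rw [h₁₃.J_eq, hJ]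
  rwa [eq_identityQuartic_of_invariants ha₃ hb₃ hc₃ hI₃ hJ₃] at h₁₃

end NormalForm

/-! ## §5 `PGL₂(K)`-equivalence preserves zeros in `ℙ¹(K)` -/

/-- If `g = γ · f` (twisted action) has a zero `v ∈ ℙ¹(K)` then `f` has the zero `vγ`. [folklore] -/
theorem PGL2Equiv.exists_eval_eq_zero {K : Type*} [Field K] {f g : BinaryQuartic K}
    (h : PGL2Equiv f g) (hg : ∃ x y : K, (x ≠ 0 ∨ y ≠ 0) ∧ g.eval x y = 0) :
    ∃ x y : K, (x ≠ 0 ∨ y ≠ 0) ∧ f.eval x y = 0 := by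
  obtain ⟨γ, hγ, rfl⟩ := h
  obtain ⟨x, y, hxy, h0⟩ := hg
  rw [eval_smul, eval_subst, mul_eq_zero] at h0
  have h0' := h0.resolve_left (inv_ne_zero (pow_ne_zero 2 hγ))
  refine ⟨x * γ 0 0 + y * γ 1 0, x * γ 0 1 + y * γ 1 1, ?_, h0'⟩
  by_contra hne
  simp only [ne_eq, not_or, not_not] at hne
  obtain ⟨e1, e2⟩ := hne
  have hx : x * γ.det = 0 := by
    rw [Matrix.det_fin_two]; linear_combination γ 1 1 * e1 - γ 1 0 * e2
  have hy : y * γ.det = 0 := by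
    rw [Matrix.det_fin_two]; linear_combination (-(γ 0 1)) * e1 + γ 0 0 * e2
  rcases hxy with hx0 | hy0
  · exact hx0 ((mul_eq_zero.mp hx).resolve_right hγ)
  · exact hy0 ((mul_eq_zero.mp hy).resolve_right hγ)

/-! ## §6 The one reducible class -/

section Classes

/-- The identity quartic `4x³y + 4A xy³ + 4B y⁴` is locally soluble (it vanishes at `[1:0]`).
[folklore] -/
theorem isLocallySoluble_identityQuartic (A B : ℤ) :
    (⟨0, 4, 0, 4 * A, 4 * B⟩ : BinaryQuartic ℤ).IsLocallySoluble :=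
  ⟨⟨1, 0, 0, Or.inl one_ne_zero, by simp [eval, map]⟩,
    fun p _ ↦ ⟨1, 0, 0, Or.inl one_ne_zero, by simp [eval, map]⟩⟩

/-- The identity quartic is reducible (`a = 0`). [folklore] -/
theorem not_isIrreducible_identityQuartic (A B : ℤ) :
    ¬ (⟨0, 4, 0, 4 * A, 4 * B⟩ : BinaryQuartic ℤ).IsIrreducible := fun h ↦ h.1 rfl

/-- `ℚ`-image of the identity quartic. [folklore] -/
theorem map_identityQuartic (A B : ℤ) :
    (⟨0, 4, 0, 4 * A, 4 * B⟩ : BinaryQuartic ℤ).map (Int.castRingHom ℚ) =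
      ⟨0, 4, 0, 4 * (A : ℚ), 4 * (B : ℚ)⟩ := by
  ext <;> simp [map]

variable {A B : ℤ}

/-- **Dichotomy.** For `4A³ + 27B² ≠ 0` and `x³ + Ax + B` without rational root, an integral
quartic with invariants `(2⁴·(−3A), 2⁶·(−27B))` is either irreducible or `PGL₂(ℚ)`-equivalent to the
identity quartic `4x³y + 4Axy³ + 4By⁴` (Bhargava–Shankar, held arXiv text p. 33: the identity of
`S₂(E)` versus the classes of irreducible forms). [cite: BhargavaShankarAnnals2015, §5.2 p. 33 (arXiv:1006.1002v2 numbering)] -/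
theorem isIrreducible_or_pgl2Equiv_identityQuartic (hΔ : 4 * A ^ 3 + 27 * B ^ 2 ≠ 0)
    (hT : ∀ r : ℚ, r ^ 3 + A * r + B ≠ 0) {f : BinaryQuartic ℤ} (hI : f.I = 2 ^ 4 * (-3 * A))
    (hJ : f.J = 2 ^ 6 * (-27 * B)) :
    f.IsIrreducible ∨
      PGL2Equiv ((⟨0, 4, 0, 4 * A, 4 * B⟩ : BinaryQuartic ℤ).map (Int.castRingHom ℚ))
        (f.map (Int.castRingHom ℚ)) := by
  by_cases hf : f.IsIrreducible
  · exact Or.inl hf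
  right
  have hz := exists_eval_eq_zero_of_not_isIrreducible hI hJ hT hf
  have hIq : (f.map (Int.castRingHom ℚ)).I = 2 ^ 4 * (-3 * (A : ℚ)) := by
    rw [I_map, hI, eq_intCast]; push_cast; ring
  have hJq : (f.map (Int.castRingHom ℚ)).J = 2 ^ 6 * (-27 * (B : ℚ)) := by
    rw [J_map, hJ, eq_intCast]; push_cast; ring
  have hΔq : 4 * (A : ℚ) ^ 3 + 27 * (B : ℚ) ^ 2 ≠ 0 := by exact_mod_cast hΔ
  rw [map_identityQuartic]
  exact (pgl2Equiv_identityQuartic_of_eval_eq_zero hIq hJq hΔq hz).symm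

/-- Within the invariants of a curve without rational `2`-torsion, irreducibility is a
`PGL₂(ℚ)`-class invariant: a reducible form has a rational zero
(`exists_eval_eq_zero_of_not_isIrreducible`), zeros transport along equivalences, and an
irreducible form has none. [folklore] -/
theorem PGL2Equiv.isIrreducible_iff (hT : ∀ r : ℚ, r ^ 3 + A * r + B ≠ 0) {f g : BinaryQuartic ℤ}
    (hfI : f.I = 2 ^ 4 * (-3 * A)) (hfJ : f.J = 2 ^ 6 * (-27 * B))
    (hgI : g.I = 2 ^ 4 * (-3 * A)) (hgJ : g.J = 2 ^ 6 * (-27 * B))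
    (h : PGL2Equiv (f.map (Int.castRingHom ℚ)) (g.map (Int.castRingHom ℚ))) :
    f.IsIrreducible ↔ g.IsIrreducible := by
  constructor
  · intro hf
    by_contra hg
    obtain ⟨x, y, hxy, h0⟩ :=
      h.exists_eval_eq_zero (exists_eval_eq_zero_of_not_isIrreducible hgI hgJ hT hg)
    exact hf.eval_ne_zero hxy h0
  · intro hg
    by_contra hf
    obtain ⟨x, y, hxy, h0⟩ :=
      h.symm.exists_eval_eq_zero (exists_eval_eq_zero_of_not_isIrreducible hfI hfJ hT hf)
    exact hg.eval_ne_zero hxy h0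

/-- **The classes of locally soluble forms are those of the irreducible ones plus the identity
class** (Bhargava–Shankar, held arXiv text p. 33, for curves without rational `2`-torsion): with
`S` the set of locally soluble integral quartics with invariants `(2⁴·(−3A), 2⁶·(−27B))` and `S'`
its subset of irreducible forms, the set of `PGL₂(ℚ)`-classes (traces on `S`, resp. `S'`) of `S`
is obtained from that of `S'` by adding the class of `4x³y + 4Axy³ + 4By⁴`, which is not a class
of `S'`. [cite: BhargavaShankarAnnals2015, §5.2 p. 33 (arXiv:1006.1002v2 numbering)] -/
theorem classes_eq_insert (hΔ : 4 * A ^ 3 + 27 * B ^ 2 ≠ 0) (hT : ∀ r : ℚ, r ^ 3 + A * r + B ≠ 0) :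
    let S : Set (BinaryQuartic ℤ) :=
      {f | f.IsLocallySoluble ∧ f.I = 2 ^ 4 * (-3 * A) ∧ f.J = 2 ^ 6 * (-27 * B)}
    let S' : Set (BinaryQuartic ℤ) :=
      {f | f.IsLocallySoluble ∧ f.IsIrreducible ∧ f.I = 2 ^ 4 * (-3 * A) ∧ f.J = 2 ^ 6 * (-27 * B)}
    let cl : Set (BinaryQuartic ℤ) → BinaryQuartic ℤ → Set (BinaryQuartic ℤ) := fun T f ↦
      {g | g ∈ T ∧ PGL2Equiv (f.map (Int.castRingHom ℚ)) (g.map (Int.castRingHom ℚ))}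
    cl S '' S = insert (cl S ⟨0, 4, 0, 4 * A, 4 * B⟩) (cl S' '' S') ∧
      cl S ⟨0, 4, 0, 4 * A, 4 * B⟩ ∉ cl S' '' S' := by
  intro S S' cl
  have hqS : (⟨0, 4, 0, 4 * A, 4 * B⟩ : BinaryQuartic ℤ) ∈ S :=
    ⟨isLocallySoluble_identityQuartic A B, invariants_identityQuartic A B⟩
  have hS'S : S' ⊆ S := fun f hf ↦ ⟨hf.1, hf.2.2⟩
  -- classes of irreducible forms are the same in `S` and `S'`
  have hirr : ∀ f ∈ S', cl S f = cl S' f := by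
    intro f hf
    ext g
    simp only [cl, Set.mem_setOf_eq]
    constructor
    · rintro ⟨hg, hfg⟩
      exact ⟨⟨hg.1, (PGL2Equiv.isIrreducible_iff hT hf.2.2.1 hf.2.2.2 hg.2.1 hg.2.2 hfg).mp hf.2.1,
        hg.2⟩, hfg⟩
    · rintro ⟨hg, hfg⟩
      exact ⟨hS'S hg, hfg⟩
  -- classes of reducible forms coincide with the identity class
  have hred : ∀ f ∈ S, ¬ f.IsIrreducible → cl S f = cl S ⟨0, 4, 0, 4 * A, 4 * B⟩ := by
    intro f hf hfi
    have hq := (isIrreducible_or_pgl2Equiv_identityQuartic hΔ hT hf.2.1 hf.2.2).resolve_left hfi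
    ext g
    simp only [cl, Set.mem_setOf_eq]
    exact ⟨fun ⟨hg, hfg⟩ ↦ ⟨hg, hq.trans hfg⟩, fun ⟨hg, hqg⟩ ↦ ⟨hg, hq.symm.trans hqg⟩⟩
  constructor
  · apply Set.eq_of_subset_of_subset
    · rintro _ ⟨f, hf, rfl⟩
      by_cases hfi : f.IsIrreducible
      · refine Set.mem_insert_of_mem _ ⟨f, ⟨hf.1, hfi, hf.2⟩, ?_⟩
        exact (hirr f ⟨hf.1, hfi, hf.2⟩).symm
      · rw [hred f hf hfi]
        exact Set.mem_insert _ _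
    · rintro T hT'
      rcases Set.mem_insert_iff.mp hT' with rfl | ⟨f, hf, rfl⟩
      · exact ⟨_, hqS, rfl⟩
      · exact ⟨f, hS'S hf, hirr f hf⟩
  · rintro ⟨f, hf, hcl⟩
    have hq : (⟨0, 4, 0, 4 * A, 4 * B⟩ : BinaryQuartic ℤ) ∈ cl S ⟨0, 4, 0, 4 * A, 4 * B⟩ :=
      ⟨hqS, PGL2Equiv.refl _⟩
    rw [← hcl] at hq
    exact not_isIrreducible_identityQuartic A B hq.1.2.1

/-- **Counting form** of `classes_eq_insert`: for `(A, B)` with `4A³ + 27B² ≠ 0` and no rational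
`2`-torsion, if the locally soluble integral quartics with invariants `(2⁴·(−3A), 2⁶·(−27B))` fall
into finitely many `PGL₂(ℚ)`-classes, then their number exceeds by exactly one the number of classes
of irreducible such forms (Bhargava–Shankar, held arXiv text p. 33: `#S₂(E) − 1` non-identity
classes). [cite: BhargavaShankarAnnals2015, §5.2 p. 33 (arXiv:1006.1002v2 numbering)] -/
theorem pgl2QClassCount_eq_succ (hΔ : 4 * A ^ 3 + 27 * B ^ 2 ≠ 0)
    (hT : ∀ r : ℚ, r ^ 3 + A * r + B ≠ 0)
    (hfin : ((fun f : BinaryQuartic ℤ ↦ {g : BinaryQuartic ℤ | g ∈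
        {f : BinaryQuartic ℤ |
          f.IsLocallySoluble ∧ f.I = 2 ^ 4 * (-3 * A) ∧ f.J = 2 ^ 6 * (-27 * B)} ∧
        PGL2Equiv (f.map (Int.castRingHom ℚ)) (g.map (Int.castRingHom ℚ))}) ''
        {f : BinaryQuartic ℤ |
          f.IsLocallySoluble ∧ f.I = 2 ^ 4 * (-3 * A) ∧ f.J = 2 ^ 6 * (-27 * B)}).Finite) :
    pgl2QClassCount {f : BinaryQuartic ℤ |
        f.IsLocallySoluble ∧ f.I = 2 ^ 4 * (-3 * A) ∧ f.J = 2 ^ 6 * (-27 * B)} =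
      pgl2QClassCount {f : BinaryQuartic ℤ | f.IsLocallySoluble ∧ f.IsIrreducible ∧
        f.I = 2 ^ 4 * (-3 * A) ∧ f.J = 2 ^ 6 * (-27 * B)} + 1 := by
  obtain ⟨heq, hnot⟩ := classes_eq_insert hΔ hT
  simp only at heq hnot
  unfold pgl2QClassCount
  rw [heq] at hfin ⊢
  exact Set.ncard_insert_of_notMem hnot (hfin.subset (Set.subset_insert _ _))

/-- **Monotonicity**: the irreducible locally soluble forms with given invariants have at most as
many `PGL₂(ℚ)`-classes as all locally soluble ones (the trace map `T ↦ T ∩ S'` sends the classes in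
`S` of elements of `S'` onto the classes of `S'`), granted finiteness. [folklore] -/
theorem pgl2QClassCount_irreducible_le (A B : ℤ)
    (hfin : ((fun f : BinaryQuartic ℤ ↦ {g : BinaryQuartic ℤ | g ∈
        {f : BinaryQuartic ℤ |
          f.IsLocallySoluble ∧ f.I = 2 ^ 4 * (-3 * A) ∧ f.J = 2 ^ 6 * (-27 * B)} ∧
        PGL2Equiv (f.map (Int.castRingHom ℚ)) (g.map (Int.castRingHom ℚ))}) ''
        {f : BinaryQuartic ℤ |
          f.IsLocallySoluble ∧ f.I = 2 ^ 4 * (-3 * A) ∧ f.J = 2 ^ 6 * (-27 * B)}).Finite) :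
    pgl2QClassCount {f : BinaryQuartic ℤ | f.IsLocallySoluble ∧ f.IsIrreducible ∧
        f.I = 2 ^ 4 * (-3 * A) ∧ f.J = 2 ^ 6 * (-27 * B)} ≤
      pgl2QClassCount {f : BinaryQuartic ℤ |
        f.IsLocallySoluble ∧ f.I = 2 ^ 4 * (-3 * A) ∧ f.J = 2 ^ 6 * (-27 * B)} := by
  unfold pgl2QClassCount
  set S : Set (BinaryQuartic ℤ) :=
    {f | f.IsLocallySoluble ∧ f.I = 2 ^ 4 * (-3 * A) ∧ f.J = 2 ^ 6 * (-27 * B)} with hS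
  set S' : Set (BinaryQuartic ℤ) :=
    {f | f.IsLocallySoluble ∧ f.IsIrreducible ∧ f.I = 2 ^ 4 * (-3 * A) ∧ f.J = 2 ^ 6 * (-27 * B)}
    with hS'
  set cl : BinaryQuartic ℤ → Set (BinaryQuartic ℤ) := fun f ↦
      {g | g ∈ S ∧ PGL2Equiv (f.map (Int.castRingHom ℚ)) (g.map (Int.castRingHom ℚ))} with hcl
  set cl' : BinaryQuartic ℤ → Set (BinaryQuartic ℤ) := fun f ↦
      {g | g ∈ S' ∧ PGL2Equiv (f.map (Int.castRingHom ℚ)) (g.map (Int.castRingHom ℚ))} with hcl'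
  have hS'S : S' ⊆ S := fun f hf ↦ ⟨hf.1, hf.2.2⟩
  have htrace : cl' '' S' = (fun T ↦ T ∩ S') '' (cl '' S') := by
    rw [Set.image_image]
    apply Set.image_congr
    intro f _
    ext g
    simp only [hcl, hcl', Set.mem_inter_iff, Set.mem_setOf_eq]
    exact ⟨fun ⟨hg, hfg⟩ ↦ ⟨⟨hS'S hg, hfg⟩, hg⟩, fun ⟨⟨_, hfg⟩, hg⟩ ↦ ⟨hg, hfg⟩⟩
  have hsub : cl '' S' ⊆ cl '' S := Set.image_mono hS'S
  have hfin' : (cl '' S').Finite := hfin.subset hsub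
  calc (cl' '' S').ncard = ((fun T ↦ T ∩ S') '' (cl '' S')).ncard := by rw [htrace]
    _ ≤ (cl '' S').ncard := Set.ncard_image_le hfin'
    _ ≤ (cl '' S).ncard := Set.ncard_le_ncard hsub hfin

end Classes

end BinaryQuartic

/-! ## §7 Prop. 5.7: curves with a rational `2`-torsion point are `O(X^{1/2})` in number -/

section TwoTorsion

/-- A rational root of the monic integral cubic `x³ + Ax + B` is an integer (rational root
theorem). [folklore] -/
theorem HasRationalTwoTorsion.exists_int {AB : ℤ × ℤ} (h : HasRationalTwoTorsion AB) :
    ∃ n : ℤ, n ^ 3 + AB.1 * n + AB.2 = 0 := by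
  obtain ⟨r, hr⟩ := h
  have hmon : (X ^ 3 + (C AB.1 * X + C AB.2) : ℤ[X]).Monic :=
    Polynomial.monic_X_pow_add ((degree_linear_le).trans_lt (by norm_num))
  have hroot : Polynomial.aeval r (X ^ 3 + (C AB.1 * X + C AB.2) : ℤ[X]) = 0 := by
    simp only [map_add, map_mul, map_pow, Polynomial.aeval_X, Polynomial.aeval_C,
      algebraMap_int_eq, Int.coe_castRingHom]
    linear_combination hr
  obtain ⟨n, hn⟩ := isInteger_of_is_root_of_monic hmon hroot
  refine ⟨n, ?_⟩
  have hn' : (n : ℚ) = r := by simpa using hn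
  have : ((n ^ 3 + AB.1 * n + AB.2 : ℤ) : ℚ) = 0 := by push_cast; rw [hn']; exact hr
  exact_mod_cast this

/-- **Rational `2`-torsion criterion** (Bhargava–Shankar, held arXiv text p. 32: "An elliptic curve
`E : y² = x³+Ax+B` over `ℚ` has a non-trivial `2`-torsion point defined over `ℚ` if and only if the
corresponding cubic equation `x³+Ax+B` has a rational root"), for the curves of the height family:
`HasRationalTwoTorsion (A, B)` iff `E_{A,B}(ℚ)` has a point `P ≠ O` with `2P = O`.
Proof: `2P = O` iff `P = −P` iff `y(P) = 0`. [cite: BhargavaShankarAnnals2015, §5.1 p. 32 (arXiv:1006.1002v2 numbering)] -/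
theorem hasRationalTwoTorsion_iff {AB : ℤ × ℤ} (hAB : IsInHeightFamily AB) :
    HasRationalTwoTorsion AB ↔
      ∃ P : (shortWeierstrass AB).toAffine.Point, P ≠ 0 ∧ (2 : ℕ) • P = 0 := by
  haveI := isElliptic_shortWeierstrass hAB
  have hnegY : ∀ x y : ℚ, (shortWeierstrass AB).toAffine.negY x y = -y := by
    intro x y; simp [WeierstrassCurve.Affine.negY, shortWeierstrass]
  have heq : ∀ x y : ℚ, (shortWeierstrass AB).toAffine.Equation x y ↔
      y ^ 2 = x ^ 3 + AB.1 * x + AB.2 := by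
    intro x y
    rw [WeierstrassCurve.Affine.equation_iff]
    simp [shortWeierstrass]
  constructor
  · rintro ⟨r, hr⟩
    have he : (shortWeierstrass AB).toAffine.Equation r 0 := by
      rw [heq]; linear_combination -hr
    have hn := (WeierstrassCurve.Affine.equation_iff_nonsingular).mp he
    refine ⟨.some r 0 hn, WeierstrassCurve.Affine.Point.some_ne_zero hn, ?_⟩
    rw [two_nsmul]
    exact WeierstrassCurve.Affine.Point.add_self_of_Y_eq (by rw [hnegY]; norm_num)
  · rintro ⟨P, hP0, h2P⟩
    rcases P with _ | ⟨x, y, h⟩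
    · exact absurd rfl hP0
    · rw [two_nsmul] at h2P
      have hy : y = (shortWeierstrass AB).toAffine.negY x y := by
        by_contra hy
        rw [WeierstrassCurve.Affine.Point.add_self_of_Y_ne hy] at h2P
        exact WeierstrassCurve.Affine.Point.some_ne_zero _ h2P
      rw [hnegY] at hy
      have hy0 : y = 0 := by linarith
      refine ⟨x, ?_⟩
      have he := h.1
      rw [heq, hy0] at he
      linear_combination -he

/-- Size of an integral (or real) root: if `r³ + ar + b = 0` with `|a| ≤ T²`, `|b| ≤ T³`, `T ≥ 0`,
then `|r| ≤ 2T` (Bhargava–Shankar, held arXiv text, Prop. 5.7 via Lemma 3.3: `O(X^{1/2+ε})`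
curves of height `< X` have a rational `2`-torsion point; here the elementary root bound).
[folklore] -/
theorem abs_root_le {a b r T : ℝ} (hT : 0 ≤ T) (h : r ^ 3 + a * r + b = 0) (ha : |a| ≤ T ^ 2)
    (hb : |b| ≤ T ^ 3) : |r| ≤ 2 * T := by
  by_contra hlt
  push Not at hlt
  have hr0 : 0 < |r| := lt_of_le_of_lt (by positivity) hlt
  have hle : T ≤ |r| / 2 := by linarith
  have hT2 : T ^ 2 ≤ |r| ^ 2 / 4 := by
    calc T ^ 2 ≤ (|r| / 2) ^ 2 := pow_le_pow_left₀ hT hle 2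
      _ = |r| ^ 2 / 4 := by ring
  have hT3 : T ^ 3 ≤ |r| ^ 3 / 8 := by
    calc T ^ 3 ≤ (|r| / 2) ^ 3 := pow_le_pow_left₀ hT hle 3
      _ = |r| ^ 3 / 8 := by ring
  have h3 : |r| ^ 3 = |a * r + b| := by
    rw [← abs_pow, show r ^ 3 = -(a * r + b) by linear_combination h, abs_neg]
  have h4 : |a * r + b| ≤ |a| * |r| + |b| := (abs_add_le _ _).trans (by rw [abs_mul])
  have h5 : |r| ^ 3 ≤ T ^ 2 * |r| + T ^ 3 := by
    rw [h3]; exact h4.trans (by gcongr)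
  have h6 : T ^ 2 * |r| ≤ |r| ^ 2 / 4 * |r| := mul_le_mul_of_nonneg_right hT2 (abs_nonneg r)
  have h7 : |r| ^ 3 ≤ 3 / 8 * |r| ^ 3 := by nlinarith [h5, h6, hT3]
  have h8 : 0 < |r| ^ 3 := pow_pos hr0 3
  nlinarith [h7, h8]

/-- The naive height is nonnegative. [folklore] -/
theorem naiveHeight_nonneg (AB : ℤ × ℤ) : 0 ≤ naiveHeight AB :=
  le_max_of_le_right (by positivity)

/-- **Bhargava–Shankar, Prop. 5.7** (held arXiv text §5.1; there `O(X^{1/2+ε})` via Lemma 3.3):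
the number of curves `E_{A,B}` of naive height `< X` in the family such that `x³ + Ax + B` has a
rational root (equivalently, with a nontrivial rational `2`-torsion point) is at most `15·X^{1/2}`.
Proof: the root `r` is an integer with `|r| ≤ 2X^{1/6}` (`abs_root_le` with `|A| < X^{1/3}`,
`|B| < X^{1/2}`), and `(A, r)` determines `B = −r³ − Ar`.
[cite: BhargavaShankarAnnals2015, Prop. 5.7 (arXiv:1006.1002v2 numbering)] -/
theorem card_filter_hasRationalTwoTorsion_le (X : ℕ) :
    (((heightFamilyBelow X).filter HasRationalTwoTorsion).card : ℝ) ≤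
      15 * (X : ℝ) ^ (1 / 2 : ℝ) := by
  rcases Nat.eq_zero_or_pos X with rfl | hX
  · have : (heightFamilyBelow 0).filter HasRationalTwoTorsion = ∅ := by
      ext AB
      simp only [Finset.mem_filter, mem_heightFamilyBelow_iff, Nat.cast_zero,
        Finset.notMem_empty, iff_false, not_and]
      intro h
      exact absurd h.2 (not_lt.mpr (naiveHeight_nonneg AB))
    rw [this]; simp
  -- `T = X^{1/6}`, `T⁶ = X`, `T ≥ 1`
  set T : ℝ := (X : ℝ) ^ (1 / 6 : ℝ) with hT
  have hX1 : (1 : ℝ) ≤ X := by exact_mod_cast hX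
  have hT0 : 0 ≤ T := Real.rpow_nonneg (by positivity) _
  have hT1 : 1 ≤ T := Real.one_le_rpow hX1 (by norm_num)
  have hT6 : T ^ 6 = X := by
    rw [hT, ← Real.rpow_natCast, ← Real.rpow_mul (by positivity)]; norm_num
  have hT3 : T ^ 3 = (X : ℝ) ^ (1 / 2 : ℝ) := by
    rw [hT, ← Real.rpow_natCast, ← Real.rpow_mul (by positivity)]; norm_num
  -- the root function and the target box
  set ρ : ℤ × ℤ → ℤ × ℤ := fun AB ↦
    (AB.1, if h : ∃ n : ℤ, n ^ 3 + AB.1 * n + AB.2 = 0 then h.choose else 0) with hρ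
  set a : ℤ := ⌊T ^ 2⌋ with ha
  set b : ℤ := ⌊2 * T⌋ with hb
  have bounds : ∀ AB ∈ (heightFamilyBelow X).filter HasRationalTwoTorsion,
      |(AB.1 : ℝ)| ≤ T ^ 2 ∧ ∃ n : ℤ, n ^ 3 + AB.1 * n + AB.2 = 0 ∧
        (ρ AB).2 = n ∧ |(n : ℝ)| ≤ 2 * T := by
    intro AB hAB
    rw [Finset.mem_filter, mem_heightFamilyBelow_iff] at hAB
    obtain ⟨⟨_, hH⟩, h2⟩ := hAB
    have hex := h2.exists_int
    have hA3 : 4 * |AB.1| ^ 3 < (X : ℤ) := lt_of_le_of_lt (le_max_left _ _) hH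
    have hB2 : 27 * AB.2 ^ 2 < (X : ℤ) := lt_of_le_of_lt (le_max_right _ _) hH
    have hA : |(AB.1 : ℝ)| ≤ T ^ 2 := by
      have h' : ((4 * |AB.1| ^ 3 : ℤ) : ℝ) < ((X : ℤ) : ℝ) := by exact_mod_cast hA3
      push_cast at h'
      have h1 : |(AB.1 : ℝ)| ^ 3 < (T ^ 2) ^ 3 :=
        calc |(AB.1 : ℝ)| ^ 3 ≤ 4 * |(AB.1 : ℝ)| ^ 3 := by
              linarith [pow_nonneg (abs_nonneg (AB.1 : ℝ)) 3]
          _ < (X : ℝ) := h'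
          _ = (T ^ 2) ^ 3 := by rw [← pow_mul]; exact hT6.symm
      exact le_of_lt (lt_of_pow_lt_pow_left₀ 3 (by positivity) h1)
    have hB : |(AB.2 : ℝ)| ≤ T ^ 3 := by
      have h' : ((27 * AB.2 ^ 2 : ℤ) : ℝ) < ((X : ℤ) : ℝ) := by exact_mod_cast hB2
      push_cast at h'
      have h1 : |(AB.2 : ℝ)| ^ 2 < (T ^ 3) ^ 2 :=
        calc |(AB.2 : ℝ)| ^ 2 = (AB.2 : ℝ) ^ 2 := sq_abs _
          _ ≤ 27 * (AB.2 : ℝ) ^ 2 := by linarith [sq_nonneg (AB.2 : ℝ)]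
          _ < (X : ℝ) := h'
          _ = (T ^ 3) ^ 2 := by rw [← pow_mul]; exact hT6.symm
      exact le_of_lt (lt_of_pow_lt_pow_left₀ 2 (by positivity) h1)
    refine ⟨hA, hex.choose, hex.choose_spec, by simp only [hρ, dif_pos hex], ?_⟩
    have hn := hex.choose_spec
    have hn' : (hex.choose : ℝ) ^ 3 + AB.1 * hex.choose + AB.2 = 0 := by exact_mod_cast hn
    exact abs_root_le hT0 hn' hA hB
  have hmaps : ∀ AB ∈ (heightFamilyBelow X).filter HasRationalTwoTorsion,
      ρ AB ∈ Finset.Icc (-a) a ×ˢ Finset.Icc (-b) b := by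
    intro AB hAB
    obtain ⟨hA, n, _, hρn, hnT⟩ := bounds AB hAB
    rw [Finset.mem_product, Finset.mem_Icc, Finset.mem_Icc, hρn]
    simp only [hρ]
    rw [abs_le] at hA hnT
    refine ⟨⟨?_, ?_⟩, ?_, ?_⟩
    · rw [neg_le, ha, Int.le_floor]; push_cast; linarith
    · rw [ha, Int.le_floor]; linarith
    · rw [neg_le, hb, Int.le_floor]; push_cast; linarith
    · rw [hb, Int.le_floor]; linarith
  have hinj : Set.InjOn ρ ((heightFamilyBelow X).filter HasRationalTwoTorsion) := by
    intro AB hAB AB' hAB' heq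
    obtain ⟨_, n, hn, hρn, _⟩ := bounds AB hAB
    obtain ⟨_, n', hn', hρn', _⟩ := bounds AB' hAB'
    have h1 : AB.1 = AB'.1 := by simpa [hρ] using congrArg Prod.fst heq
    have h2 : n = n' := by rw [← hρn, ← hρn', heq]
    refine Prod.ext h1 ?_
    subst h2
    rw [← h1] at hn'
    linear_combination hn - hn'
  have hcard := Finset.card_le_card_of_injOn ρ hmaps hinj
  rw [Finset.card_product, Int.card_Icc, Int.card_Icc] at hcard
  have ha0 : 0 ≤ a := Int.floor_nonneg.mpr (by positivity)
  have hb0 : 0 ≤ b := Int.floor_nonneg.mpr (by positivity)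
  have haT : (a : ℝ) ≤ T ^ 2 := Int.floor_le _
  have hbT : (b : ℝ) ≤ 2 * T := Int.floor_le _
  have e1 : ((a + 1 - -a).toNat : ℝ) = 2 * a + 1 := by
    have : (a + 1 - -a).toNat = a + 1 - -a := Int.toNat_of_nonneg (by omega)
    have h' : (((a + 1 - -a).toNat : ℤ) : ℝ) = ((a + 1 - -a : ℤ) : ℝ) := by rw [this]
    push_cast at h'; rw [h']; ring
  have e2 : ((b + 1 - -b).toNat : ℝ) = 2 * b + 1 := by
    have : (b + 1 - -b).toNat = b + 1 - -b := Int.toNat_of_nonneg (by omega)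
    have h' : (((b + 1 - -b).toNat : ℤ) : ℝ) = ((b + 1 - -b : ℤ) : ℝ) := by rw [this]
    push_cast at h'; rw [h']; ring
  have hcardR : (((heightFamilyBelow X).filter HasRationalTwoTorsion).card : ℝ) ≤
      (2 * a + 1) * (2 * b + 1) := by
    rw [← e1, ← e2]; exact_mod_cast hcard
  have ha0' : (0 : ℝ) ≤ a := by exact_mod_cast ha0
  have hb0' : (0 : ℝ) ≤ b := by exact_mod_cast hb0
  calc (((heightFamilyBelow X).filter HasRationalTwoTorsion).card : ℝ)
      ≤ (2 * a + 1) * (2 * b + 1) := hcardR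
    _ ≤ (2 * T ^ 2 + 1) * (4 * T + 1) :=
        mul_le_mul (by linarith) (by linarith) (by linarith) (by positivity)
    _ ≤ (3 * T ^ 2) * (5 * T) :=
        mul_le_mul (by nlinarith) (by linarith) (by linarith) (by positivity)
    _ = 15 * T ^ 3 := by ring
    _ = 15 * (X : ℝ) ^ (1 / 2 : ℝ) := by rw [hT3]

end TwoTorsion

/-! ## §8 The constant of Lemma 5.15 is positive -/

section Constant

/-- `Σ_{p ∈ s} p⁻¹⁰ ≤ 1/256` for any finite set of primes (`p⁻¹⁰ ≤ p⁻²/256` and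
`Σ_{n ≥ 2} n⁻² ≤ 1`). [folklore] -/
theorem sum_primes_inv_pow_ten_le (s : Finset Nat.Primes) :
    ∑ p ∈ s, 1 / ((p : ℕ) : ℝ) ^ 10 ≤ 1 / 256 := by
  have hle : ∀ p ∈ s, 1 / ((p : ℕ) : ℝ) ^ 10 ≤ (1 / 256) * (((p : ℕ) : ℝ) ^ 2)⁻¹ := by
    intro p _
    have hp : (2 : ℝ) ≤ (p : ℕ) := by exact_mod_cast p.2.two_le
    have hp0 : (0 : ℝ) < (p : ℕ) := by linarith
    rw [div_le_iff₀ (by positivity), mul_assoc,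
      show ((p : ℕ) : ℝ) ^ 10 = ((p : ℕ) : ℝ) ^ 2 * ((p : ℕ) : ℝ) ^ 8 by ring,
      ← mul_assoc (((p : ℕ) : ℝ) ^ 2)⁻¹, inv_mul_cancel₀ (by positivity), one_mul]
    have : (256 : ℝ) ≤ ((p : ℕ) : ℝ) ^ 8 := by
      calc (256 : ℝ) = 2 ^ 8 := by norm_num
        _ ≤ ((p : ℕ) : ℝ) ^ 8 := by gcongr
    linarith [this]
  refine (Finset.sum_le_sum hle).trans ?_
  rw [← Finset.mul_sum]
  -- compare with `Σ_{n ∈ Ioo 1 (M+1)} n⁻²  ≤ 1`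
  set M : ℕ := s.sup (fun p ↦ (p : ℕ)) with hM
  have hsub : s.map ⟨fun p : Nat.Primes ↦ (p : ℕ), Nat.Primes.coe_nat_injective⟩ ⊆
      Finset.Ioo 1 (M + 1) := by
    intro n hn
    rw [Finset.mem_map] at hn
    obtain ⟨p, hp, rfl⟩ := hn
    rw [Finset.mem_Ioo]
    exact ⟨p.2.one_lt, Nat.lt_succ_of_le (Finset.le_sup (f := fun p : Nat.Primes ↦ (p : ℕ)) hp)⟩
  have hsum : ∑ p ∈ s, (((p : ℕ) : ℝ) ^ 2)⁻¹ ≤ 1 := by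
    have h1 : ∑ p ∈ s, (((p : ℕ) : ℝ) ^ 2)⁻¹ =
        ∑ n ∈ s.map ⟨fun p : Nat.Primes ↦ (p : ℕ), Nat.Primes.coe_nat_injective⟩,
          ((n : ℝ) ^ 2)⁻¹ := by
      rw [Finset.sum_map]; rfl
    rw [h1]
    refine (Finset.sum_le_sum_of_subset_of_nonneg hsub fun _ _ _ ↦ by positivity).trans ?_
    have := sum_Ioo_inv_sq_le (α := ℝ) 1 (M + 1)
    norm_num at this
    exact this
  linarith

/-- Every finite partial Euler product `∏_{p ∈ s} (1 − p⁻¹⁰)` is at least `1/2`. [folklore] -/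
theorem half_le_prod_primes (s : Finset Nat.Primes) :
    1 / 2 ≤ ∏ p ∈ s, (1 - 1 / ((p : ℕ) : ℝ) ^ 10) := by
  -- Weierstrass: `1 − Σ aᵢ ≤ ∏ (1 − aᵢ)` for `aᵢ ∈ [0, 1]` (as in the tree's
  -- `Literature.NumberTheory.LFunctions.RobinOscillation.one_sub_sum_le_prod`, not imported here to keep the import closure
  -- inside the topic), specialised to `a_p = p⁻¹⁰`
  have hW : ∀ t : Finset Nat.Primes, 1 - ∑ p ∈ t, 1 / ((p : ℕ) : ℝ) ^ 10 ≤
      ∏ p ∈ t, (1 - 1 / ((p : ℕ) : ℝ) ^ 10) := by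
    intro t
    have h0 : ∀ p : Nat.Primes, 0 ≤ 1 / ((p : ℕ) : ℝ) ^ 10 := fun p ↦ by positivity
    have h1 : ∀ p : Nat.Primes, 1 / ((p : ℕ) : ℝ) ^ 10 ≤ 1 := fun p ↦ by
      rw [div_le_one (by have := p.2.pos; positivity)]
      have : (1 : ℝ) ≤ (p : ℕ) := by exact_mod_cast p.2.one_lt.le
      exact one_le_pow₀ this
    induction t using Finset.induction_on with
    | empty => simp
    | insert j t hj ih =>
      rw [Finset.sum_insert hj, Finset.prod_insert hj]
      have hsum : 0 ≤ ∑ p ∈ t, 1 / ((p : ℕ) : ℝ) ^ 10 := Finset.sum_nonneg fun p _ ↦ h0 p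
      have hj0 := h0 j
      have hj1 := h1 j
      calc 1 - (1 / ((j : ℕ) : ℝ) ^ 10 + ∑ p ∈ t, 1 / ((p : ℕ) : ℝ) ^ 10)
          ≤ (1 - 1 / ((j : ℕ) : ℝ) ^ 10) * (1 - ∑ p ∈ t, 1 / ((p : ℕ) : ℝ) ^ 10) := by
            nlinarith
        _ ≤ (1 - 1 / ((j : ℕ) : ℝ) ^ 10) * ∏ p ∈ t, (1 - 1 / ((p : ℕ) : ℝ) ^ 10) :=
            mul_le_mul_of_nonneg_left ih (by linarith)
  have h := hW s
  have := sum_primes_inv_pow_ten_le s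
  linarith

/-- The constant `c_F` of Lemma 5.15 is positive (`∏_p (1 − p⁻¹⁰) ≥ 1/2`). [folklore] -/
theorem heightFamilyConstant_pos : 0 < heightFamilyConstant := by
  unfold heightFamilyConstant
  apply mul_pos
  · positivity
  · by_cases hm : Multipliable (fun p : Nat.Primes ↦ (1 - 1 / ((p : ℕ) : ℝ) ^ 10))
    · have hge : (1 / 2 : ℝ) ≤ ∏' p : Nat.Primes, (1 - 1 / ((p : ℕ) : ℝ) ^ 10) :=
        ge_of_tendsto' hm.hasProd fun s ↦ half_le_prod_primes s
      linarith
    · rw [tprod_eq_one_of_not_multipliable hm]; exact one_pos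

end Constant

/-! ## Lemma 5.15: counting the height family -/

namespace HeightCount

/-! ## §A Integers of absolute value `< R` -/

/-- The integers `k` with `|k| < R`, as a `Finset`. [folklore] -/
def intBall (R : ℝ) : Finset ℤ := Finset.Ioo (-⌈R⌉) ⌈R⌉

/-- Membership in `intBall R`: `|k| < R`. [folklore] -/
theorem mem_intBall {R : ℝ} {k : ℤ} : k ∈ intBall R ↔ |(k : ℝ)| < R := by
  rw [intBall, Finset.mem_Ioo, abs_lt, neg_lt, Int.lt_ceil, Int.lt_ceil, Int.cast_neg, neg_lt]

/-- `0 ∈ intBall R` for `R > 0`. [folklore] -/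
theorem zero_mem_intBall {R : ℝ} (hR : 0 < R) : (0 : ℤ) ∈ intBall R := by
  rw [mem_intBall]; simpa using hR

/-- `#{k : |k| < R} = 2⌈R⌉ − 1` for `R > 0`. [folklore] -/
theorem card_intBall {R : ℝ} (hR : 0 < R) : ((intBall R).card : ℝ) = 2 * (⌈R⌉ : ℝ) - 1 := by
  have h1 : 0 < ⌈R⌉ := Int.ceil_pos.mpr hR
  rw [intBall, Int.card_Ioo]
  have : ((⌈R⌉ - -⌈R⌉ - 1).toNat : ℤ) = 2 * ⌈R⌉ - 1 := by
    rw [Int.toNat_of_nonneg (by omega)]; ring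
  have h' : (((⌈R⌉ - -⌈R⌉ - 1).toNat : ℤ) : ℝ) = ((2 * ⌈R⌉ - 1 : ℤ) : ℝ) := by rw [this]
  push_cast at h'
  exact h'

/-- `#{k : |k| < R} ≤ 2R + 1`. [folklore] -/
theorem card_intBall_le {R : ℝ} (hR : 0 < R) : ((intBall R).card : ℝ) ≤ 2 * R + 1 := by
  rw [card_intBall hR]; linarith [Int.ceil_lt_add_one R]

/-- `2R − 1 ≤ #{k : |k| < R}`. [folklore] -/
theorem le_card_intBall {R : ℝ} (hR : 0 < R) : 2 * R - 1 ≤ ((intBall R).card : ℝ) := by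
  rw [card_intBall hR]; linarith [Int.le_ceil R]

/-- `|#{k : |k| < R} − 2R| ≤ 1`. [folklore] -/
theorem abs_card_intBall_sub_le {R : ℝ} (hR : 0 < R) : |((intBall R).card : ℝ) - 2 * R| ≤ 1 := by
  rw [abs_le]; constructor <;> linarith [card_intBall_le hR, le_card_intBall hR]

/-- Multiples of `m ≥ 1` of absolute value `< R` correspond to integers of absolute value `< R/m`.
[folklore] -/
theorem card_filter_dvd_intBall {R : ℝ} {m : ℤ} (hm : 0 < m) :
    ((intBall R).filter (fun k ↦ m ∣ k)).card = (intBall (R / m)).card := by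
  have hmR : (0 : ℝ) < m := by exact_mod_cast hm
  symm
  refine Finset.card_bij (fun j _ ↦ m * j) (fun j hj ↦ ?_) (fun j₁ _ j₂ _ h ↦ ?_) (fun k hk ↦ ?_)
  · rw [Finset.mem_filter, mem_intBall]
    rw [mem_intBall] at hj
    refine ⟨?_, dvd_mul_right m j⟩
    rw [Int.cast_mul, abs_mul, abs_of_pos hmR]
    rwa [lt_div_iff₀' hmR] at hj
  · exact mul_left_cancel₀ hm.ne' h
  · rw [Finset.mem_filter, mem_intBall] at hk
    obtain ⟨hk, j, rfl⟩ := hk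
    refine ⟨j, ?_, rfl⟩
    rw [mem_intBall, lt_div_iff₀' hmR]
    rwa [Int.cast_mul, abs_mul, abs_of_pos hmR] at hk


/-! ## §B The box `4|A|³ < X`, `27B² < X` -/

/-- `R₁(X) = (X/4)^{1/3}`: `4|A|³ < X ↔ |A| < R₁(X)`. [folklore] -/
def R₁ (X : ℕ) : ℝ := ((X : ℝ) / 4) ^ (1 / 3 : ℝ)

/-- `R₂(X) = (X/27)^{1/2}`: `27B² < X ↔ |B| < R₂(X)`. [folklore] -/
def R₂ (X : ℕ) : ℝ := ((X : ℝ) / 27) ^ (1 / 2 : ℝ)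

/-- `R₁ ≥ 0`. [folklore] -/
theorem R₁_nonneg (X : ℕ) : 0 ≤ R₁ X := Real.rpow_nonneg (by positivity) _
/-- `R₂ ≥ 0`. [folklore] -/
theorem R₂_nonneg (X : ℕ) : 0 ≤ R₂ X := Real.rpow_nonneg (by positivity) _

/-- `R₁³ = X/4`. [folklore] -/
theorem R₁_pow (X : ℕ) : R₁ X ^ 3 = (X : ℝ) / 4 := by
  rw [R₁, one_div]; exact Real.rpow_inv_natCast_pow (by positivity) (by norm_num)

/-- `R₂² = X/27`. [folklore] -/
theorem R₂_pow (X : ℕ) : R₂ X ^ 2 = (X : ℝ) / 27 := by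
  rw [R₂, one_div]; exact Real.rpow_inv_natCast_pow (by positivity) (by norm_num)

/-- `R₁ > 0` for `X ≥ 1`. [folklore] -/
theorem R₁_pos {X : ℕ} (hX : 1 ≤ X) : 0 < R₁ X := by
  have hX' : (0 : ℝ) < X := by exact_mod_cast hX
  rw [R₁]; exact Real.rpow_pos_of_pos (by positivity) _

/-- `R₂ > 0` for `X ≥ 1`. [folklore] -/
theorem R₂_pos {X : ℕ} (hX : 1 ≤ X) : 0 < R₂ X := by
  have hX' : (0 : ℝ) < X := by exact_mod_cast hX
  rw [R₂]; exact Real.rpow_pos_of_pos (by positivity) _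

/-- `R₁ R₂ = X^{5/6} / (4^{1/3} 27^{1/2})`. [folklore] -/
theorem R₁_mul_R₂ (X : ℕ) :
    R₁ X * R₂ X = (X : ℝ) ^ (5 / 6 : ℝ) / ((4 : ℝ) ^ (1 / 3 : ℝ) * (27 : ℝ) ^ (1 / 2 : ℝ)) := by
  rw [R₁, R₂, Real.div_rpow (by positivity) (by norm_num),
    Real.div_rpow (by positivity) (by norm_num), div_mul_div_comm,
    ← Real.rpow_add' (by positivity) (by norm_num)]
  norm_num

/-- The box of pairs `(A, B)` with `4|A|³ < X` and `27B² < X`. [folklore] -/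
def box (X : ℕ) : Finset (ℤ × ℤ) := intBall (R₁ X) ×ˢ intBall (R₂ X)

/-- `|A| < R₁(X) ↔ 4|A|³ < X`. [folklore] -/
theorem abs_lt_R₁_iff {X : ℕ} {A : ℤ} : |(A : ℝ)| < R₁ X ↔ 4 * |A| ^ 3 < (X : ℤ) := by
  have h0 := R₁_nonneg X
  constructor
  · intro h
    have h3 : |(A : ℝ)| ^ 3 < R₁ X ^ 3 := pow_lt_pow_left₀ h (abs_nonneg _) (by norm_num)
    rw [R₁_pow] at h3
    have : ((4 * |A| ^ 3 : ℤ) : ℝ) < ((X : ℤ) : ℝ) := by push_cast; linarith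
    exact_mod_cast this
  · intro h
    have h' : ((4 * |A| ^ 3 : ℤ) : ℝ) < ((X : ℤ) : ℝ) := by exact_mod_cast h
    push_cast at h'
    have h3 : |(A : ℝ)| ^ 3 < R₁ X ^ 3 := by rw [R₁_pow]; linarith
    exact lt_of_pow_lt_pow_left₀ 3 h0 h3

/-- `|B| < R₂(X) ↔ 27B² < X`. [folklore] -/
theorem abs_lt_R₂_iff {X : ℕ} {B : ℤ} : |(B : ℝ)| < R₂ X ↔ 27 * B ^ 2 < (X : ℤ) := by
  have h0 := R₂_nonneg X
  constructor
  · intro h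
    have h2 : |(B : ℝ)| ^ 2 < R₂ X ^ 2 := pow_lt_pow_left₀ h (abs_nonneg _) (by norm_num)
    rw [R₂_pow, sq_abs] at h2
    have : ((27 * B ^ 2 : ℤ) : ℝ) < ((X : ℤ) : ℝ) := by push_cast; linarith
    exact_mod_cast this
  · intro h
    have h' : ((27 * B ^ 2 : ℤ) : ℝ) < ((X : ℤ) : ℝ) := by exact_mod_cast h
    push_cast at h'
    have h2 : |(B : ℝ)| ^ 2 < R₂ X ^ 2 := by rw [R₂_pow, sq_abs]; linarith
    exact lt_of_pow_lt_pow_left₀ 2 h0 h2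

/-- Membership in the box is `H(E_{A,B}) < X`. [folklore] -/
theorem mem_box {X : ℕ} {AB : ℤ × ℤ} : AB ∈ box X ↔ naiveHeight AB < X := by
  rw [box, Finset.mem_product, mem_intBall, mem_intBall, abs_lt_R₁_iff, abs_lt_R₂_iff, naiveHeight,
    max_lt_iff]

/-- The curves of height `< X` are the members of the family in the box. [folklore] -/
theorem heightFamilyBelow_eq (X : ℕ) : heightFamilyBelow X = (box X).filter IsInHeightFamily := by
  ext AB
  rw [mem_heightFamilyBelow_iff, Finset.mem_filter, mem_box, and_comm]

/-! ## §C Inclusion–exclusion for the truncated family -/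

/-- The divisibility condition `d⁴ ∣ A ∧ d⁶ ∣ B`. [folklore] -/
def DvdCond (d : ℕ) (AB : ℤ × ℤ) : Prop := (d : ℤ) ^ 4 ∣ AB.1 ∧ (d : ℤ) ^ 6 ∣ AB.2

/-- Truncated minimality: no prime `p ≤ Y` with `p⁴ ∣ A` and `p⁶ ∣ B`. [folklore] -/
def MinimalLE (Y : ℕ) (AB : ℤ × ℤ) : Prop := ∀ p ∈ Nat.primesLE Y, ¬ DvdCond p AB

/-- For a set `t` of primes, `(∀ p ∈ t, p^k ∣ A) ↔ (∏ t)^k ∣ A`. [folklore] -/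
theorem forall_pow_dvd_iff {t : Finset ℕ} (ht : ∀ p ∈ t, p.Prime) (k : ℕ) (A : ℤ) :
    (∀ p ∈ t, (p : ℤ) ^ k ∣ A) ↔ ((∏ p ∈ t, p : ℕ) : ℤ) ^ k ∣ A := by
  rw [Nat.cast_prod, ← Finset.prod_pow]
  constructor
  · intro h
    refine Finset.prod_dvd_of_coprime ?_ h
    intro p hp q hq hne
    have hc : Nat.Coprime (p ^ k) (q ^ k) :=
      Nat.Coprime.pow k k ((Nat.coprime_primes (ht p hp) (ht q hq)).mpr hne)
    have := Nat.isCoprime_iff_coprime.mpr hc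
    simpa using this
  · intro h p hp
    exact (Finset.dvd_prod_of_mem (fun p : ℕ ↦ (p : ℤ) ^ k) hp).trans h

/-- For a set `t` of primes, `(∀ p ∈ t, p⁴ ∣ A ∧ p⁶ ∣ B) ↔ (∏ t)⁴ ∣ A ∧ (∏ t)⁶ ∣ B`. [folklore] -/
theorem forall_dvdCond_iff {t : Finset ℕ} (ht : ∀ p ∈ t, p.Prime) (AB : ℤ × ℤ) :
    (∀ p ∈ t, DvdCond p AB) ↔ DvdCond (∏ p ∈ t, p) AB := by
  simp only [DvdCond]
  rw [← forall_pow_dvd_iff ht 4, ← forall_pow_dvd_iff ht 6]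
  exact ⟨fun h ↦ ⟨fun p hp ↦ (h p hp).1, fun p hp ↦ (h p hp).2⟩,
    fun h p hp ↦ ⟨h.1 p hp, h.2 p hp⟩⟩

/-- Indicator form of inclusion–exclusion:
`1_{MinimalLE Y}(AB) = Σ_{t ⊆ Nat.primesLE Y} (−1)^{|t|} 1_{DvdCond (∏ t)}(AB)`. [folklore] -/
theorem indicator_minimalLE (Y : ℕ) (AB : ℤ × ℤ) :
    (if MinimalLE Y AB then (1 : ℝ) else 0) =
      ∑ t ∈ (Nat.primesLE Y).powerset, (-1 : ℝ) ^ t.card *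
        (if DvdCond (∏ p ∈ t, p) AB then 1 else 0) := by
  -- left side as a product of `1 - indicator`
  have hprod : (if MinimalLE Y AB then (1 : ℝ) else 0) =
      ∏ p ∈ Nat.primesLE Y, (-(if DvdCond p AB then (1 : ℝ) else 0) + 1) := by
    by_cases h : MinimalLE Y AB
    · rw [if_pos h]
      symm
      refine Finset.prod_eq_one fun p hp ↦ ?_
      rw [if_neg (h p hp)]; ring
    · rw [if_neg h]
      simp only [MinimalLE, not_forall, not_not] at h
      obtain ⟨p, hp, hpc⟩ := h
      symm
      exact Finset.prod_eq_zero hp (by rw [if_pos hpc]; ring)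
  rw [hprod, Finset.prod_add]
  refine Finset.sum_congr rfl fun t ht ↦ ?_
  rw [Finset.mem_powerset] at ht
  have ht' : ∀ p ∈ t, p.Prime := fun p hp ↦ (Nat.mem_primesLE.mp (ht hp)).2
  rw [Finset.prod_const_one, mul_one, Finset.prod_neg, Finset.prod_boole]
  by_cases hc : ∀ p ∈ t, DvdCond p AB
  · rw [if_pos hc, if_pos ((forall_dvdCond_iff ht' AB).mp hc)]
  · rw [if_neg hc, if_neg (mt (forall_dvdCond_iff ht' AB).mpr hc)]

/-- Inclusion–exclusion count of the truncated family in the box. [folklore] -/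
theorem card_filter_minimalLE (X Y : ℕ) :
    (((box X).filter (MinimalLE Y)).card : ℝ) =
      ∑ t ∈ (Nat.primesLE Y).powerset, (-1 : ℝ) ^ t.card *
        (((box X).filter (DvdCond (∏ p ∈ t, p))).card : ℝ) := by
  rw [Finset.natCast_card_filter]
  simp_rw [indicator_minimalLE, Finset.natCast_card_filter]
  rw [Finset.sum_comm]
  refine Finset.sum_congr rfl fun t _ ↦ ?_
  rw [Finset.mul_sum]

/-- Count of the pairs in the box satisfying `d⁴ ∣ A`, `d⁶ ∣ B`. [folklore] -/
theorem card_filter_dvdCond (X : ℕ) {d : ℕ} (hd : 0 < d) :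
    ((box X).filter (DvdCond d)).card =
      (intBall (R₁ X / (d : ℝ) ^ 4)).card * (intBall (R₂ X / (d : ℝ) ^ 6)).card := by
  have h4 : (0 : ℤ) < (d : ℤ) ^ 4 := by positivity
  have h6 : (0 : ℤ) < (d : ℤ) ^ 6 := by positivity
  have key : (box X).filter (DvdCond d) =
      (intBall (R₁ X)).filter (fun A ↦ (d : ℤ) ^ 4 ∣ A) ×ˢ
        (intBall (R₂ X)).filter (fun B ↦ (d : ℤ) ^ 6 ∣ B) := by
    ext ⟨A, B⟩
    simp only [box, DvdCond, Finset.mem_filter, Finset.mem_product]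
    tauto
  rw [key, Finset.card_product, card_filter_dvd_intBall h4, card_filter_dvd_intBall h6]
  push_cast
  rfl

/-- The main term: `Σ_{t ⊆ P} (−1)^{|t|} (2R₁/D_t⁴)(2R₂/D_t⁶) = 4 R₁ R₂ ∏_{p ∈ P} (1 − p⁻¹⁰)`. [folklore] -/
theorem mainTerm_eq (X Y : ℕ) :
    ∑ t ∈ (Nat.primesLE Y).powerset, (-1 : ℝ) ^ t.card *
        ((2 * (R₁ X / ((∏ p ∈ t, p : ℕ) : ℝ) ^ 4)) * (2 * (R₂ X / ((∏ p ∈ t, p : ℕ) : ℝ) ^ 6))) =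
      4 * (R₁ X * R₂ X) * ∏ p ∈ Nat.primesLE Y, (1 - 1 / (p : ℝ) ^ 10) := by
  have hrhs : ∏ p ∈ Nat.primesLE Y, (1 - 1 / (p : ℝ) ^ 10) =
      ∏ p ∈ Nat.primesLE Y, (-(1 / (p : ℝ) ^ 10) + 1) := by
    refine Finset.prod_congr rfl fun p _ ↦ by ring
  rw [hrhs, Finset.prod_add, Finset.mul_sum]
  refine Finset.sum_congr rfl fun t ht ↦ ?_
  rw [Finset.prod_const_one, mul_one, Finset.prod_neg, Finset.prod_div_distrib,
    Finset.prod_const_one, Finset.prod_pow, Nat.cast_prod]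
  have hpos : (0 : ℝ) < ∏ p ∈ t, (p : ℝ) := by
    refine Finset.prod_pos fun p hp ↦ ?_
    rw [Finset.mem_powerset] at ht
    exact_mod_cast (Nat.mem_primesLE.mp (ht hp)).2.pos
  field_simp
  ring


/-- Elementary: `|xy − uv| ≤ u + v + 1` when `|x − u| ≤ 1`, `|y − v| ≤ 1`, `u, v, y ≥ 0`, `y ≤ v + 1`. [folklore] -/
theorem abs_mul_sub_mul_le {x y u v : ℝ} (hx : |x - u| ≤ 1) (hy : |y - v| ≤ 1) (hu : 0 ≤ u)
    (hy0 : 0 ≤ y) : |x * y - u * v| ≤ u + v + 1 := by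
  have hyv : y ≤ v + 1 := by linarith [(abs_le.mp hy).2]
  calc |x * y - u * v| = |(x - u) * y + u * (y - v)| := by ring_nf
    _ ≤ |(x - u) * y| + |u * (y - v)| := abs_add_le _ _
    _ = |x - u| * y + u * |y - v| := by rw [abs_mul, abs_mul, abs_of_nonneg hy0, abs_of_nonneg hu]
    _ ≤ 1 * y + u * 1 := by gcongr
    _ ≤ u + v + 1 := by linarith

/-- The truncated count is `4R₁R₂ ∏_{p ≤ Y}(1 − p⁻¹⁰)` up to `2^{π(Y)} (2R₁ + 2R₂ + 1)`. [folklore] -/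
theorem abs_card_filter_minimalLE_sub_le {X : ℕ} (hX : 1 ≤ X) (Y : ℕ) :
    |(((box X).filter (MinimalLE Y)).card : ℝ) -
        4 * (R₁ X * R₂ X) * ∏ p ∈ Nat.primesLE Y, (1 - 1 / (p : ℝ) ^ 10)| ≤
      2 ^ (Nat.primesLE Y).card * (2 * R₁ X + 2 * R₂ X + 1) := by
  rw [card_filter_minimalLE, ← mainTerm_eq, ← Finset.sum_sub_distrib]
  refine (Finset.abs_sum_le_sum_abs _ _).trans ?_
  have hR₁ := R₁_pos hX
  have hR₂ := R₂_pos hX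
  have hterm : ∀ t ∈ (Nat.primesLE Y).powerset,
      |(-1 : ℝ) ^ t.card * (((box X).filter (DvdCond (∏ p ∈ t, p))).card : ℝ) -
        (-1 : ℝ) ^ t.card * ((2 * (R₁ X / ((∏ p ∈ t, p : ℕ) : ℝ) ^ 4)) *
          (2 * (R₂ X / ((∏ p ∈ t, p : ℕ) : ℝ) ^ 6)))| ≤ 2 * R₁ X + 2 * R₂ X + 1 := by
    intro t ht
    rw [Finset.mem_powerset] at ht
    have hD : 0 < ∏ p ∈ t, p := Finset.prod_pos fun p hp ↦ (Nat.mem_primesLE.mp (ht hp)).2.pos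
    have hDR : (1 : ℝ) ≤ ((∏ p ∈ t, p : ℕ) : ℝ) := by exact_mod_cast hD
    rw [← mul_sub, abs_mul, abs_pow, abs_neg, abs_one, one_pow, one_mul,
      card_filter_dvdCond X hD, Nat.cast_mul]
    set D : ℝ := ((∏ p ∈ t, p : ℕ) : ℝ) with hDdef
    have hD4 : (1 : ℝ) ≤ D ^ 4 := one_le_pow₀ hDR
    have hD6 : (1 : ℝ) ≤ D ^ 6 := one_le_pow₀ hDR
    have h1 : 0 < R₁ X / D ^ 4 := by positivity
    have h2 : 0 < R₂ X / D ^ 6 := by positivity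
    have key := abs_mul_sub_mul_le (abs_card_intBall_sub_le h1) (abs_card_intBall_sub_le h2)
      (by positivity) (Nat.cast_nonneg _)
    refine key.trans ?_
    have e1 : R₁ X / D ^ 4 ≤ R₁ X := div_le_self hR₁.le hD4
    have e2 : R₂ X / D ^ 6 ≤ R₂ X := div_le_self hR₂.le hD6
    linarith
  refine (Finset.sum_le_sum hterm).trans ?_
  rw [Finset.sum_const, Finset.card_powerset, nsmul_eq_mul]
  push_cast
  rfl

/-! ## §D The exceptional pairs -/

/-- Pairs with `4A³ + 27B² = 0` in the box: at most one `A` per `B`. [folklore] -/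
theorem card_filter_disc_le {X : ℕ} (hX : 1 ≤ X) :
    (((box X).filter (fun AB : ℤ × ℤ ↦ 4 * AB.1 ^ 3 + 27 * AB.2 ^ 2 = 0)).card : ℝ) ≤
      2 * R₂ X + 1 := by
  have hinj : Set.InjOn (fun AB : ℤ × ℤ ↦ AB.2)
      ((box X).filter (fun AB : ℤ × ℤ ↦ 4 * AB.1 ^ 3 + 27 * AB.2 ^ 2 = 0)) := by
    intro AB hAB AB' hAB' h
    simp only [Finset.coe_filter, Set.mem_setOf_eq] at hAB hAB'
    simp only at h
    have h3 : AB.1 ^ 3 = AB'.1 ^ 3 := by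
      have := hAB.2; have := hAB'.2; rw [h] at *; linarith
    have h1 : AB.1 = AB'.1 := (Odd.strictMono_pow (by decide : Odd 3)).injective h3
    exact Prod.ext h1 h
  have hmaps : ∀ AB ∈ (box X).filter (fun AB : ℤ × ℤ ↦ 4 * AB.1 ^ 3 + 27 * AB.2 ^ 2 = 0),
      (fun AB : ℤ × ℤ ↦ AB.2) AB ∈ intBall (R₂ X) := by
    intro AB hAB
    rw [Finset.mem_filter, box, Finset.mem_product] at hAB
    exact hAB.1.2
  have := Finset.card_le_card_of_injOn _ hmaps hinj
  calc (((box X).filter (fun AB : ℤ × ℤ ↦ 4 * AB.1 ^ 3 + 27 * AB.2 ^ 2 = 0)).card : ℝ)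
      ≤ (intBall (R₂ X)).card := by exact_mod_cast this
    _ ≤ 2 * R₂ X + 1 := card_intBall_le (R₂_pos hX)

/-- A prime power dividing a nonzero integer is at most its absolute value. [folklore] -/
theorem le_of_pow_dvd {p k : ℕ} (hk : k ≠ 0) {A : ℤ} (hA : A ≠ 0) (h : (p : ℤ) ^ k ∣ A) :
    (p : ℝ) ≤ |(A : ℝ)| := by
  have h1 : ((p ^ k : ℕ) : ℤ) ∣ A := by exact_mod_cast h
  have h2 : p ^ k ∣ A.natAbs := Int.natCast_dvd.mp h1
  have h3 : p ^ k ≤ A.natAbs := Nat.le_of_dvd (Int.natAbs_pos.mpr hA) h2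
  have h4 : p ≤ p ^ k := Nat.le_self_pow hk p
  have h5 : ((p : ℕ) : ℝ) ≤ (A.natAbs : ℝ) := by exact_mod_cast h4.trans h3
  rwa [Nat.cast_natAbs, Int.cast_abs] at h5

/-- Per prime: nonzero pairs in the box with `p⁴ ∣ A`, `p⁶ ∣ B` number at most
`4R₁R₂/p¹⁰ + 2R₁/p⁴ + 2R₂/p⁶`. [folklore] -/
theorem card_filter_dvdCond_ne_zero_le {X : ℕ} (hX : 1 ≤ X) {p : ℕ} (hp : 0 < p) :
    (((box X).filter (fun AB ↦ AB ≠ (0, 0) ∧ DvdCond p AB)).card : ℝ) ≤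
      4 * (R₁ X * R₂ X) / (p : ℝ) ^ 10 + 2 * R₁ X / (p : ℝ) ^ 4 + 2 * R₂ X / (p : ℝ) ^ 6 := by
  have hR₁ := R₁_pos hX
  have hR₂ := R₂_pos hX
  have hp' : (0 : ℝ) < p := by exact_mod_cast hp
  have h0 : ((0, 0) : ℤ × ℤ) ∈ (box X).filter (DvdCond p) := by
    rw [Finset.mem_filter, box, Finset.mem_product]
    exact ⟨⟨zero_mem_intBall hR₁, zero_mem_intBall hR₂⟩, dvd_zero _, dvd_zero _⟩
  have heq : (box X).filter (fun AB ↦ AB ≠ (0, 0) ∧ DvdCond p AB) =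
      ((box X).filter (DvdCond p)).erase (0, 0) := by
    ext AB
    simp only [Finset.mem_filter, Finset.mem_erase]
    tauto
  rw [heq, Finset.card_erase_of_mem h0, card_filter_dvdCond X hp]
  have hc : 1 ≤ (intBall (R₁ X / (p : ℝ) ^ 4)).card * (intBall (R₂ X / (p : ℝ) ^ 6)).card := by
    have := Finset.card_pos.mpr ⟨_, h0⟩
    rw [card_filter_dvdCond X hp] at this
    exact this
  rw [Nat.cast_sub hc, Nat.cast_mul, Nat.cast_one]
  have b1 := card_intBall_le (R := R₁ X / (p : ℝ) ^ 4) (by positivity)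
  have b2 := card_intBall_le (R := R₂ X / (p : ℝ) ^ 6) (by positivity)
  have n1 : (0 : ℝ) ≤ (intBall (R₁ X / (p : ℝ) ^ 4)).card := Nat.cast_nonneg _
  have e : (2 * (R₁ X / (p : ℝ) ^ 4) + 1) * (2 * (R₂ X / (p : ℝ) ^ 6) + 1) - 1 =
      4 * (R₁ X * R₂ X) / (p : ℝ) ^ 10 + 2 * R₁ X / (p : ℝ) ^ 4 + 2 * R₂ X / (p : ℝ) ^ 6 := by
    field_simp; ring
  rw [← e]
  have h2pos : 0 ≤ 2 * (R₂ X / (p : ℝ) ^ 6) + 1 := by positivity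
  nlinarith [mul_le_mul b1 b2 (Nat.cast_nonneg _) (by positivity)]

/-- The nonzero pairs in the box divisible by `(p⁴, p⁶)` for some prime `p > Y ≥ 1` number at most
`8R₁R₂/(Y+1) + 2R₁ + 2R₂`. [folklore] -/
theorem card_filter_exists_dvdCond_le {X : ℕ} (hX : 1 ≤ X) {Y : ℕ} (hY : 1 ≤ Y) :
    (((box X).filter (fun AB ↦ AB ≠ (0, 0) ∧ ∃ p, p.Prime ∧ Y < p ∧ DvdCond p AB)).card : ℝ) ≤
      8 * (R₁ X * R₂ X) / (Y + 1) + 2 * R₁ X + 2 * R₂ X := by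
  have hR₁ := R₁_pos hX
  have hR₂ := R₂_pos hX
  set L : ℕ := ⌈R₁ X⌉.toNat + ⌈R₂ X⌉.toNat with hL
  -- every relevant prime is `≤ L`
  have hsub : (box X).filter (fun AB ↦ AB ≠ (0, 0) ∧ ∃ p, p.Prime ∧ Y < p ∧ DvdCond p AB) ⊆
      ((Finset.Ioc Y L).filter Nat.Prime).biUnion
        (fun p ↦ (box X).filter (fun AB ↦ AB ≠ (0, 0) ∧ DvdCond p AB)) := by
    intro AB hAB
    rw [Finset.mem_filter] at hAB
    obtain ⟨hbox, hne, p, hp, hYp, hdvd⟩ := hAB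
    rw [Finset.mem_biUnion]
    refine ⟨p, ?_, Finset.mem_filter.mpr ⟨hbox, hne, hdvd⟩⟩
    rw [Finset.mem_filter, Finset.mem_Ioc]
    refine ⟨⟨hYp, ?_⟩, hp⟩
    rw [box, Finset.mem_product, mem_intBall, mem_intBall] at hbox
    by_cases hA : AB.1 = 0
    · have hB : AB.2 ≠ 0 := by
        intro hB; exact hne (Prod.ext hA hB)
      have h1 := le_of_pow_dvd (by norm_num) hB hdvd.2
      have h2 : (p : ℝ) < R₂ X := h1.trans_lt hbox.2
      have h3 : (p : ℤ) ≤ ⌈R₂ X⌉ := Int.le_ceil_iff.mpr (by push_cast; linarith)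
      have h4 : p ≤ ⌈R₂ X⌉.toNat := by
        have : (p : ℤ) ≤ (⌈R₂ X⌉.toNat : ℤ) := h3.trans (Int.self_le_toNat _)
        exact_mod_cast this
      omega
    · have h1 := le_of_pow_dvd (by norm_num) hA hdvd.1
      have h2 : (p : ℝ) < R₁ X := h1.trans_lt hbox.1
      have h3 : (p : ℤ) ≤ ⌈R₁ X⌉ := Int.le_ceil_iff.mpr (by push_cast; linarith)
      have h4 : p ≤ ⌈R₁ X⌉.toNat := by
        have : (p : ℤ) ≤ (⌈R₁ X⌉.toNat : ℤ) := h3.trans (Int.self_le_toNat _)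
        exact_mod_cast this
      omega
  have hcard := (Finset.card_le_card hsub).trans Finset.card_biUnion_le
  have hcardR : (((box X).filter (fun AB ↦ AB ≠ (0, 0) ∧ ∃ p, p.Prime ∧ Y < p ∧ DvdCond p AB)).card
      : ℝ) ≤ ∑ p ∈ (Finset.Ioc Y L).filter Nat.Prime,
        (((box X).filter (fun AB ↦ AB ≠ (0, 0) ∧ DvdCond p AB)).card : ℝ) := by
    exact_mod_cast hcard
  refine hcardR.trans ?_
  -- bound each term and extend the sum to all integers in `(Y, L]`
  have hterm : ∀ p ∈ (Finset.Ioc Y L).filter Nat.Prime,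
      (((box X).filter (fun AB ↦ AB ≠ (0, 0) ∧ DvdCond p AB)).card : ℝ) ≤
        (4 * (R₁ X * R₂ X) + 2 * R₁ X + 2 * R₂ X) * ((p : ℝ) ^ 2)⁻¹ := by
    intro p hp
    rw [Finset.mem_filter, Finset.mem_Ioc] at hp
    have hp2 : (2 : ℝ) ≤ p := by exact_mod_cast hp.2.two_le
    have hp0 : (0 : ℝ) < p := by linarith
    refine (card_filter_dvdCond_ne_zero_le hX hp.2.pos).trans ?_
    have i10 : ((p : ℝ) ^ 10)⁻¹ ≤ ((p : ℝ) ^ 2)⁻¹ := by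
      apply inv_anti₀ (by positivity); exact pow_le_pow_right₀ (by linarith) (by norm_num)
    have i4 : ((p : ℝ) ^ 4)⁻¹ ≤ ((p : ℝ) ^ 2)⁻¹ := by
      apply inv_anti₀ (by positivity); exact pow_le_pow_right₀ (by linarith) (by norm_num)
    have i6 : ((p : ℝ) ^ 6)⁻¹ ≤ ((p : ℝ) ^ 2)⁻¹ := by
      apply inv_anti₀ (by positivity); exact pow_le_pow_right₀ (by linarith) (by norm_num)
    rw [div_eq_mul_inv, div_eq_mul_inv, div_eq_mul_inv]
    have hA : 0 ≤ 4 * (R₁ X * R₂ X) := by positivity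
    nlinarith [mul_le_mul_of_nonneg_left i10 hA,
      mul_le_mul_of_nonneg_left i4 (by positivity : 0 ≤ 2 * R₁ X),
      mul_le_mul_of_nonneg_left i6 (by positivity : 0 ≤ 2 * R₂ X)]
  refine (Finset.sum_le_sum hterm).trans ?_
  rw [← Finset.mul_sum]
  have hsum : ∑ p ∈ (Finset.Ioc Y L).filter Nat.Prime, ((p : ℝ) ^ 2)⁻¹ ≤ 2 / (Y + 1) := by
    calc ∑ p ∈ (Finset.Ioc Y L).filter Nat.Prime, ((p : ℝ) ^ 2)⁻¹
        ≤ ∑ p ∈ Finset.Ioo Y (L + 1), ((p : ℝ) ^ 2)⁻¹ := by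
          refine Finset.sum_le_sum_of_subset_of_nonneg ?_ fun _ _ _ ↦ by positivity
          intro p hp
          rw [Finset.mem_filter, Finset.mem_Ioc] at hp
          rw [Finset.mem_Ioo]; omega
      _ ≤ 2 / (Y + 1) := sum_Ioo_inv_sq_le Y (L + 1)
  have hY' : (2 : ℝ) / (Y + 1) ≤ 1 := by
    rw [div_le_one (by positivity)]
    have : (1 : ℝ) ≤ Y := by exact_mod_cast hY
    linarith
  have hpos : 0 ≤ 4 * (R₁ X * R₂ X) + 2 * R₁ X + 2 * R₂ X := by positivity
  calc (4 * (R₁ X * R₂ X) + 2 * R₁ X + 2 * R₂ X) *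
        ∑ p ∈ (Finset.Ioc Y L).filter Nat.Prime, ((p : ℝ) ^ 2)⁻¹
      ≤ (4 * (R₁ X * R₂ X) + 2 * R₁ X + 2 * R₂ X) * (2 / (Y + 1)) :=
        mul_le_mul_of_nonneg_left hsum hpos
    _ = 8 * (R₁ X * R₂ X) / (Y + 1) + (2 * R₁ X + 2 * R₂ X) * (2 / (Y + 1)) := by ring
    _ ≤ 8 * (R₁ X * R₂ X) / (Y + 1) + (2 * R₁ X + 2 * R₂ X) * 1 := by gcongr
    _ = 8 * (R₁ X * R₂ X) / (Y + 1) + 2 * R₁ X + 2 * R₂ X := by ring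

/-- The truncated family consists of the family, the degenerate pairs and the pairs failing
minimality at a prime `> Y`. [folklore] -/
theorem filter_minimalLE_subset (X Y : ℕ) :
    (box X).filter (MinimalLE Y) ⊆ heightFamilyBelow X ∪
      ((box X).filter (fun AB : ℤ × ℤ ↦ 4 * AB.1 ^ 3 + 27 * AB.2 ^ 2 = 0) ∪
        (box X).filter (fun AB ↦ AB ≠ (0, 0) ∧ ∃ p, p.Prime ∧ Y < p ∧ DvdCond p AB)) := by
  intro AB hAB
  rw [Finset.mem_filter] at hAB
  obtain ⟨hbox, hmin⟩ := hAB
  rw [Finset.mem_union, Finset.mem_union, heightFamilyBelow_eq, Finset.mem_filter,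
    Finset.mem_filter, Finset.mem_filter]
  by_cases hdisc : 4 * AB.1 ^ 3 + 27 * AB.2 ^ 2 = 0
  · exact Or.inr (Or.inl ⟨hbox, hdisc⟩)
  by_cases hfam : IsInHeightFamily AB
  · exact Or.inl ⟨hbox, hfam⟩
  right; right
  refine ⟨hbox, ?_, ?_⟩
  · rintro rfl; exact hdisc (by simp)
  · unfold IsInHeightFamily at hfam
    push Not at hfam
    obtain ⟨p, hp, hdvd⟩ := hfam hdisc
    have hd : DvdCond p AB := hdvd
    refine ⟨p, hp, ?_, hd⟩
    by_contra hle
    exact hmin p (Nat.mem_primesLE.mpr ⟨not_lt.mp hle, hp⟩) hd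

/-- Two-sided estimate for `N_X` against the truncated count. [folklore] -/
theorem card_heightFamilyBelow_bounds {X : ℕ} (hX : 1 ≤ X) {Y : ℕ} (hY : 1 ≤ Y) :
    ((heightFamilyBelow X).card : ℝ) ≤ ((box X).filter (MinimalLE Y)).card ∧
      (((box X).filter (MinimalLE Y)).card : ℝ) - (2 * R₂ X + 1) -
          (8 * (R₁ X * R₂ X) / (Y + 1) + 2 * R₁ X + 2 * R₂ X) ≤ (heightFamilyBelow X).card := by
  constructor
  · have : heightFamilyBelow X ⊆ (box X).filter (MinimalLE Y) := by
      intro AB hAB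
      rw [heightFamilyBelow_eq, Finset.mem_filter] at hAB
      rw [Finset.mem_filter]
      exact ⟨hAB.1, fun p hp ↦ hAB.2.2 p (Nat.mem_primesLE.mp hp).2⟩
    exact_mod_cast Finset.card_le_card this
  · have h1 := Finset.card_le_card (filter_minimalLE_subset X Y)
    have h2 := Finset.card_union_le (heightFamilyBelow X)
      ((box X).filter (fun AB : ℤ × ℤ ↦ 4 * AB.1 ^ 3 + 27 * AB.2 ^ 2 = 0) ∪
        (box X).filter (fun AB ↦ AB ≠ (0, 0) ∧ ∃ p, p.Prime ∧ Y < p ∧ DvdCond p AB))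
    have h3 := Finset.card_union_le
      ((box X).filter (fun AB : ℤ × ℤ ↦ 4 * AB.1 ^ 3 + 27 * AB.2 ^ 2 = 0))
      ((box X).filter (fun AB ↦ AB ≠ (0, 0) ∧ ∃ p, p.Prime ∧ Y < p ∧ DvdCond p AB))
    have h : ((box X).filter (MinimalLE Y)).card ≤ (heightFamilyBelow X).card +
        ((((box X).filter (fun AB : ℤ × ℤ ↦ 4 * AB.1 ^ 3 + 27 * AB.2 ^ 2 = 0)).card) +
          (((box X).filter
            (fun AB ↦ AB ≠ (0, 0) ∧ ∃ p, p.Prime ∧ Y < p ∧ DvdCond p AB)).card)) := by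
      omega
    have h' : (((box X).filter (MinimalLE Y)).card : ℝ) ≤ (heightFamilyBelow X).card +
        ((((box X).filter (fun AB : ℤ × ℤ ↦ 4 * AB.1 ^ 3 + 27 * AB.2 ^ 2 = 0)).card : ℝ) +
          (((box X).filter (fun AB ↦ AB ≠ (0, 0) ∧ ∃ p, p.Prime ∧ Y < p ∧ DvdCond p AB)).card
            : ℝ)) := by exact_mod_cast h
    linarith [card_filter_disc_le hX, card_filter_exists_dvdCond_le hX hY]


/-! ## §E Limits -/


/-- `R₁(X) ≤ X^{1/3}`. [folklore] -/
theorem R₁_le {X : ℕ} : R₁ X ≤ 1 * (X : ℝ) ^ (1 / 3 : ℝ) := by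
  rw [one_mul, R₁]
  exact Real.rpow_le_rpow (by positivity) (by linarith [Nat.cast_nonneg (α := ℝ) X]) (by norm_num)

/-- `R₂(X) ≤ X^{1/2}`. [folklore] -/
theorem R₂_le {X : ℕ} : R₂ X ≤ 1 * (X : ℝ) ^ (1 / 2 : ℝ) := by
  rw [one_mul, R₂]
  exact Real.rpow_le_rpow (by positivity) (by linarith [Nat.cast_nonneg (α := ℝ) X]) (by norm_num)

/-- `R₁(X)/X^{5/6} → 0`. [folklore] -/
theorem tendsto_R₁_div : Tendsto (fun X : ℕ ↦ R₁ X / (X : ℝ) ^ (5 / 6 : ℝ)) atTop (𝓝 0) :=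
  tendsto_div_rpow_fiveSixths_of_le (a := 1 / 3) (C := 1) (by norm_num) R₁_nonneg (fun X _ ↦ R₁_le)

/-- `R₂(X)/X^{5/6} → 0`. [folklore] -/
theorem tendsto_R₂_div : Tendsto (fun X : ℕ ↦ R₂ X / (X : ℝ) ^ (5 / 6 : ℝ)) atTop (𝓝 0) :=
  tendsto_div_rpow_fiveSixths_of_le (a := 1 / 2) (C := 1) (by norm_num) R₂_nonneg (fun X _ ↦ R₂_le)

/-- `1/X^{5/6} → 0`. [folklore] -/
theorem tendsto_one_div : Tendsto (fun X : ℕ ↦ (1 : ℝ) / (X : ℝ) ^ (5 / 6 : ℝ)) atTop (𝓝 0) :=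
  tendsto_div_rpow_fiveSixths_of_le (a := 0) (C := 1) (by norm_num) (fun _ ↦ zero_le_one)
    (fun X _ ↦ by rw [Real.rpow_zero, mul_one])

/-- `4 R₁ R₂ / X^{5/6}` is the constant `4/(4^{1/3} 27^{1/2})`. [folklore] -/
theorem four_R₁R₂_div {X : ℕ} (hX : 1 ≤ X) :
    4 * (R₁ X * R₂ X) / (X : ℝ) ^ (5 / 6 : ℝ) =
      4 / ((4 : ℝ) ^ (1 / 3 : ℝ) * (27 : ℝ) ^ (1 / 2 : ℝ)) := by
  have hX0 : (0 : ℝ) < (X : ℝ) ^ (5 / 6 : ℝ) := Real.rpow_pos_of_pos (by exact_mod_cast hX) _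
  rw [R₁_mul_R₂]
  field_simp

/-- The Euler factor at `10` over the primes `≤ Y` tends to the full product. [folklore] -/
theorem tendsto_prod_primesLE :
    Tendsto (fun Y : ℕ ↦ ∏ p ∈ Nat.primesLE Y, (1 - 1 / (p : ℝ) ^ 10)) atTop
      (𝓝 (∏' p : Nat.Primes, (1 - 1 / ((p : ℕ) : ℝ) ^ 10))) := by
  set f : ℕ → ℝ := fun p ↦ 1 - 1 / (p : ℝ) ^ 10 with hf
  set g : ℕ → ℝ := ({p | Nat.Prime p} : Set ℕ).mulIndicator f with hg
  -- the product over the primes is the product over `ℕ` of the indicator-extended function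
  have key : ∏' p : Nat.Primes, (1 - 1 / ((p : ℕ) : ℝ) ^ 10) = ∏' n, g n :=
    tprod_subtype ({p | Nat.Prime p} : Set ℕ) f
  have hg1 : ∀ n, g n = 1 + (if n.Prime then -(1 / (n : ℝ) ^ 10) else 0) := by
    intro n
    simp only [hg, Set.mulIndicator_apply, Set.mem_setOf_eq, hf]
    split_ifs <;> ring
  have hsum : Summable (fun n : ℕ ↦ ‖(if n.Prime then -(1 / (n : ℝ) ^ 10) else 0)‖) := by
    refine Summable.of_nonneg_of_le (fun n ↦ norm_nonneg _) (fun n ↦ ?_)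
      (Real.summable_one_div_nat_pow.mpr (by norm_num : 1 < 10))
    split_ifs
    · rw [norm_neg, Real.norm_of_nonneg (by positivity)]
    · rw [norm_zero]; positivity
  have hmul : Multipliable g := by
    have := multipliable_one_add_of_summable hsum
    exact this.congr fun n ↦ (hg1 n).symm
  have hT := (hmul.hasProd.tendsto_prod_nat).comp (tendsto_add_atTop_nat 1)
  rw [key]
  refine hT.congr fun Y ↦ ?_
  simp only [Function.comp_apply]
  rw [Nat.primesLE_eq_filter_range, Finset.prod_filter]
  refine Finset.prod_congr rfl fun n _ ↦ ?_
  simp only [hg, Set.mulIndicator_apply, Set.mem_setOf_eq, hf]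

end HeightCount

open HeightCount in
/-- **Bhargava–Shankar, Lemma 5.15 for the family of all elliptic curves** — discharge of the
named fact `card_heightFamilyBelow_asymptotic`: `N_X / X^{5/6} → c_F`. Proof: inclusion–exclusion
over the primes `≤ Y` gives the truncated count `4R₁R₂∏_{p≤Y}(1 − p⁻¹⁰) + O_Y(X^{1/2})` with
`4R₁R₂ = (4/(4^{1/3}27^{1/2})) X^{5/6}`; the pairs failing minimality only at primes `> Y` are
`≤ 8R₁R₂/(Y+1) + O(X^{1/2})`, the degenerate pairs `4A³ + 27B² = 0` are `O(X^{1/2})`; let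
`X → ∞` and then `Y → ∞`. [cite: BhargavaShankarAnnals2015, Lemma 5.15 (arXiv:1006.1002v2 numbering)] -/
theorem card_heightFamilyBelow_asymptotic_holds : card_heightFamilyBelow_asymptotic := by
  unfold card_heightFamilyBelow_asymptotic heightFamilyConstant
  set c₀ : ℝ := 4 / ((4 : ℝ) ^ (1 / 3 : ℝ) * (27 : ℝ) ^ (1 / 2 : ℝ)) with hc₀
  set Pinf : ℝ := ∏' p : Nat.Primes, (1 - 1 / ((p : ℕ) : ℝ) ^ 10) with hPinf
  have hc₀pos : 0 < c₀ := by positivity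
  rw [Metric.tendsto_atTop]
  intro ε hε
  -- choose `Y`
  have hPY := tendsto_prod_primesLE
  rw [Metric.tendsto_atTop] at hPY
  obtain ⟨Y₁, hY₁⟩ := hPY (ε / (3 * c₀)) (by positivity)
  obtain ⟨Y₂, hY₂⟩ : ∃ Y₂ : ℕ, 2 * c₀ / ((Y₂ : ℝ) + 1) < ε / 3 := by
    obtain ⟨n, hn⟩ := exists_nat_gt (2 * c₀ / (ε / 3))
    refine ⟨n, ?_⟩
    rw [div_lt_iff₀ (by positivity)]
    rw [div_lt_iff₀ (by positivity)] at hn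
    nlinarith
  set Y : ℕ := max (max Y₁ Y₂) 1 with hY
  have hY1 : 1 ≤ Y := le_max_right _ _
  have hYY₁ : Y₁ ≤ Y := (le_max_left _ _).trans (le_max_left _ _)
  have hYY₂ : Y₂ ≤ Y := (le_max_right _ _).trans (le_max_left _ _)
  have hPclose : |c₀ * ∏ p ∈ Nat.primesLE Y, (1 - 1 / (p : ℝ) ^ 10) - c₀ * Pinf| < ε / 3 := by
    have := hY₁ Y hYY₁
    rw [Real.dist_eq] at this
    rw [← mul_sub, abs_mul, abs_of_pos hc₀pos]
    calc c₀ * |∏ p ∈ Nat.primesLE Y, (1 - 1 / (p : ℝ) ^ 10) - Pinf| < c₀ * (ε / (3 * c₀)) := by gcongr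
      _ = ε / 3 := by field_simp
  have htail : 2 * c₀ / ((Y : ℝ) + 1) < ε / 3 := by
    refine lt_of_le_of_lt ?_ hY₂
    have : (Y₂ : ℝ) ≤ Y := by exact_mod_cast hYY₂
    gcongr
  -- the error terms tend to `0`
  set err : ℕ → ℝ := fun X ↦ (2 ^ (Nat.primesLE Y).card * (2 * R₁ X + 2 * R₂ X + 1) +
      (2 * R₂ X + 1) + (2 * R₁ X + 2 * R₂ X)) / (X : ℝ) ^ (5 / 6 : ℝ) with herr
  have herr0 : Tendsto err atTop (𝓝 0) := by
    have h := ((((tendsto_R₁_div.const_mul 2).add (tendsto_R₂_div.const_mul 2)).add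
      tendsto_one_div).const_mul (2 ^ (Nat.primesLE Y).card)).add
      (((tendsto_R₂_div.const_mul 2).add tendsto_one_div).add
        ((tendsto_R₁_div.const_mul 2).add (tendsto_R₂_div.const_mul 2)))
    simp only [mul_zero, add_zero] at h
    refine h.congr fun X ↦ ?_
    simp only [herr]
    ring
  rw [Metric.tendsto_atTop] at herr0
  obtain ⟨X₀, hX₀⟩ := herr0 (ε / 3) (by positivity)
  refine ⟨max X₀ 1, fun X hX ↦ ?_⟩
  have hX1 : 1 ≤ X := (le_max_right _ _).trans hX
  have hXX₀ : X₀ ≤ X := (le_max_left _ _).trans hX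
  have herrX : |err X| < ε / 3 := by
    have := hX₀ X hXX₀; rwa [Real.dist_eq, sub_zero] at this
  have hP : (0 : ℝ) < (X : ℝ) ^ (5 / 6 : ℝ) := Real.rpow_pos_of_pos (by exact_mod_cast hX1) _
  -- the two-sided bounds, divided by `X^{5/6}`
  obtain ⟨hup, hlow⟩ := card_heightFamilyBelow_bounds hX1 hY1
  have htr := abs_card_filter_minimalLE_sub_le hX1 Y
  have hmain : 4 * (R₁ X * R₂ X) * (∏ p ∈ Nat.primesLE Y, (1 - 1 / (p : ℝ) ^ 10)) /
      (X : ℝ) ^ (5 / 6 : ℝ) = c₀ * ∏ p ∈ Nat.primesLE Y, (1 - 1 / (p : ℝ) ^ 10) := by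
    rw [mul_div_right_comm, four_R₁R₂_div hX1]
  have htailX : (8 * (R₁ X * R₂ X) / ((Y : ℝ) + 1)) / (X : ℝ) ^ (5 / 6 : ℝ) =
      2 * c₀ / ((Y : ℝ) + 1) := by
    rw [div_div, mul_comm ((Y : ℝ) + 1), ← div_div,
      show 8 * (R₁ X * R₂ X) = 2 * (4 * (R₁ X * R₂ X)) by ring, mul_div_assoc,
      four_R₁R₂_div hX1, mul_div_assoc]
  rw [Real.dist_eq, abs_lt]
  rw [abs_le] at htr
  obtain ⟨htr1, htr2⟩ := htr
  have herr1 := (abs_lt.mp herrX).2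
  simp only [herr] at herr1
  constructor
  · -- lower bound
    have h1 : (((box X).filter (MinimalLE Y)).card : ℝ) / (X : ℝ) ^ (5 / 6 : ℝ) -
        (2 * R₂ X + 1) / (X : ℝ) ^ (5 / 6 : ℝ) -
        (8 * (R₁ X * R₂ X) / ((Y : ℝ) + 1) + 2 * R₁ X + 2 * R₂ X) / (X : ℝ) ^ (5 / 6 : ℝ) ≤
        ((heightFamilyBelow X).card : ℝ) / (X : ℝ) ^ (5 / 6 : ℝ) := by
      rw [← sub_div, ← sub_div]; exact div_le_div_of_nonneg_right hlow hP.le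
    have h2 : c₀ * (∏ p ∈ Nat.primesLE Y, (1 - 1 / (p : ℝ) ^ 10)) -
        2 ^ (Nat.primesLE Y).card * (2 * R₁ X + 2 * R₂ X + 1) / (X : ℝ) ^ (5 / 6 : ℝ) ≤
        (((box X).filter (MinimalLE Y)).card : ℝ) / (X : ℝ) ^ (5 / 6 : ℝ) := by
      rw [← hmain, ← sub_div]; exact div_le_div_of_nonneg_right (by linarith) hP.le
    have h3 : (8 * (R₁ X * R₂ X) / ((Y : ℝ) + 1) + 2 * R₁ X + 2 * R₂ X) / (X : ℝ) ^ (5 / 6 : ℝ)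
        = 2 * c₀ / ((Y : ℝ) + 1) + (2 * R₁ X + 2 * R₂ X) / (X : ℝ) ^ (5 / 6 : ℝ) := by
      rw [← htailX, ← add_div, add_assoc]
    have hsplit : (2 ^ (Nat.primesLE Y).card * (2 * R₁ X + 2 * R₂ X + 1)) / (X : ℝ) ^ (5 / 6 : ℝ) +
        (2 * R₂ X + 1) / (X : ℝ) ^ (5 / 6 : ℝ) + (2 * R₁ X + 2 * R₂ X) / (X : ℝ) ^ (5 / 6 : ℝ) =
        (2 ^ (Nat.primesLE Y).card * (2 * R₁ X + 2 * R₂ X + 1) + (2 * R₂ X + 1) +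
          (2 * R₁ X + 2 * R₂ X)) / (X : ℝ) ^ (5 / 6 : ℝ) := by
      rw [← add_div, ← add_div]
    have hP1 := (abs_lt.mp hPclose).1
    linarith
  · -- upper bound
    have h1 : ((heightFamilyBelow X).card : ℝ) / (X : ℝ) ^ (5 / 6 : ℝ) ≤
        (((box X).filter (MinimalLE Y)).card : ℝ) / (X : ℝ) ^ (5 / 6 : ℝ) :=
      div_le_div_of_nonneg_right hup hP.le
    have h2 : (((box X).filter (MinimalLE Y)).card : ℝ) / (X : ℝ) ^ (5 / 6 : ℝ) ≤
        c₀ * (∏ p ∈ Nat.primesLE Y, (1 - 1 / (p : ℝ) ^ 10)) +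
        2 ^ (Nat.primesLE Y).card * (2 * R₁ X + 2 * R₂ X + 1) / (X : ℝ) ^ (5 / 6 : ℝ) := by
      rw [← hmain, ← add_div]; exact div_le_div_of_nonneg_right (by linarith) hP.le
    have hsplit : (2 ^ (Nat.primesLE Y).card * (2 * R₁ X + 2 * R₂ X + 1)) / (X : ℝ) ^ (5 / 6 : ℝ) ≤
        (2 ^ (Nat.primesLE Y).card * (2 * R₁ X + 2 * R₂ X + 1) + (2 * R₂ X + 1) +
          (2 * R₁ X + 2 * R₂ X)) / (X : ℝ) ^ (5 / 6 : ℝ) := by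
      apply div_le_div_of_nonneg_right _ hP.le
      linarith [R₁_nonneg X, R₂_nonneg X]
    have hP2 := (abs_lt.mp hPclose).2
    linarith

/-! ## §9 Assembly: Theorem 1.1 from Lemma 5.15, eq. (31), Thm 5.6 and Prop. 5.8 -/

section Assembly

open BinaryQuartic WeierstrassCurve


/-- Finiteness and positivity input: for `(A, B)` in the family, `Sel^(2)(E_{A,B}/ℚ)` is finite
(AEC X.4.2(b), `finite_selmerGroup_holds`) and nonempty, so by Thm 5.6
(`bhargavaShankar_card_selmerTwo_eq`) the locally soluble quartics with invariants
`(2⁴I(E), 2⁶J(E))` have finitely many (`= #Sel^(2) ≥ 1`) classes. [folklore] -/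
theorem classes_finite_of_card_selmerTwo_eq (h56 : bhargavaShankar_card_selmerTwo_eq)
    {AB : ℤ × ℤ} (hAB : IsInHeightFamily AB) :
    ((fun f : BinaryQuartic ℤ ↦ {g : BinaryQuartic ℤ | g ∈
        {f : BinaryQuartic ℤ | f.IsLocallySoluble ∧ f.I = 2 ^ 4 * (-3 * AB.1) ∧
          f.J = 2 ^ 6 * (-27 * AB.2)} ∧
        PGL2Equiv (f.map (Int.castRingHom ℚ)) (g.map (Int.castRingHom ℚ))}) ''
        {f : BinaryQuartic ℤ | f.IsLocallySoluble ∧ f.I = 2 ^ 4 * (-3 * AB.1) ∧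
          f.J = 2 ^ 6 * (-27 * AB.2)}).Finite := by
  haveI := isElliptic_shortWeierstrass hAB
  haveI : Finite ((shortWeierstrass AB).selmerGroup 2) :=
    (shortWeierstrass AB).finite_selmerGroup_holds two_ne_zero
  have hpos : 0 < Nat.card ((shortWeierstrass AB).selmerGroup 2) := Nat.card_pos
  rw [h56 AB hAB] at hpos
  exact Set.finite_of_ncard_ne_zero hpos.ne'


/-- Pointwise: `#Sel^(2)(E_{A,B}) = #irreducible classes + 1` for curves of the family without
rational `2`-torsion, from Thm 5.6 and `pgl2QClassCount_eq_succ`. [cite: BhargavaShankarAnnals2015, §5.2 p. 33 (arXiv:1006.1002v2 numbering)] -/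
theorem card_selmerTwo_eq_succ (h56 : bhargavaShankar_card_selmerTwo_eq) {AB : ℤ × ℤ}
    (hAB : IsInHeightFamily AB) (hT : ¬ HasRationalTwoTorsion AB) :
    Nat.card ((shortWeierstrass AB).selmerGroup 2) =
      pgl2QClassCount {f : BinaryQuartic ℤ | f.IsLocallySoluble ∧ f.IsIrreducible ∧
        f.I = 2 ^ 4 * (-3 * AB.1) ∧ f.J = 2 ^ 6 * (-27 * AB.2)} + 1 := by
  rw [h56 AB hAB]
  have hT' : ∀ r : ℚ, r ^ 3 + AB.1 * r + AB.2 ≠ 0 := fun r hr ↦ hT ⟨r, hr⟩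
  exact pgl2QClassCount_eq_succ hAB.1 hT' (classes_finite_of_card_selmerTwo_eq h56 hAB)

/-- Pointwise: `#irreducible classes ≤ #Sel^(2)(E_{A,B})` for every curve of the family, from
Thm 5.6 and `pgl2QClassCount_irreducible_le`. [folklore] -/
theorem irredClassCount_le_card_selmerTwo (h56 : bhargavaShankar_card_selmerTwo_eq) {AB : ℤ × ℤ}
    (hAB : IsInHeightFamily AB) :
    pgl2QClassCount {f : BinaryQuartic ℤ | f.IsLocallySoluble ∧ f.IsIrreducible ∧
        f.I = 2 ^ 4 * (-3 * AB.1) ∧ f.J = 2 ^ 6 * (-27 * AB.2)} ≤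
      Nat.card ((shortWeierstrass AB).selmerGroup 2) := by
  rw [h56 AB hAB]
  exact pgl2QClassCount_irreducible_le AB.1 AB.2 (classes_finite_of_card_selmerTwo_eq h56 hAB)

/-- The counting identity behind Theorem 1.1: over the curves of height `< X`,
`Σ #S₂(E) = Σ_all #irr − Σ_{2-tors} #irr + (N_X − N_T) + Σ_{2-tors} #S₂(E)`, splitting the
family into curves with/without rational `2`-torsion and using `#S₂ = #irr + 1` on the latter
(Bhargava–Shankar, held arXiv text §5.4). [cite: BhargavaShankarAnnals2015, §5.4 (arXiv:1006.1002v2 numbering)] -/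
theorem sum_card_selmerTwo_eq (h56 : bhargavaShankar_card_selmerTwo_eq) (X : ℕ) :
    (∑ AB ∈ heightFamilyBelow X, (Nat.card ((shortWeierstrass AB).selmerGroup 2) : ℝ)) =
      (∑ AB ∈ heightFamilyBelow X, (pgl2QClassCount {f : BinaryQuartic ℤ | f.IsLocallySoluble ∧
          f.IsIrreducible ∧ f.I = 2 ^ 4 * (-3 * AB.1) ∧ f.J = 2 ^ 6 * (-27 * AB.2)} : ℝ)) -
        (∑ AB ∈ (heightFamilyBelow X).filter HasRationalTwoTorsion,
          (pgl2QClassCount {f : BinaryQuartic ℤ | f.IsLocallySoluble ∧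
            f.IsIrreducible ∧ f.I = 2 ^ 4 * (-3 * AB.1) ∧ f.J = 2 ^ 6 * (-27 * AB.2)} : ℝ)) +
        (((heightFamilyBelow X).card : ℝ) -
          (((heightFamilyBelow X).filter HasRationalTwoTorsion).card : ℝ)) +
        ∑ AB ∈ (heightFamilyBelow X).filter HasRationalTwoTorsion,
          (Nat.card ((shortWeierstrass AB).selmerGroup 2) : ℝ) := by
  rw [← Finset.sum_filter_add_sum_filter_not (heightFamilyBelow X) HasRationalTwoTorsion
      (fun AB ↦ (Nat.card ((shortWeierstrass AB).selmerGroup 2) : ℝ)),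
    ← Finset.sum_filter_add_sum_filter_not (heightFamilyBelow X) HasRationalTwoTorsion
      (fun AB ↦ (pgl2QClassCount {f : BinaryQuartic ℤ | f.IsLocallySoluble ∧
          f.IsIrreducible ∧ f.I = 2 ^ 4 * (-3 * AB.1) ∧ f.J = 2 ^ 6 * (-27 * AB.2)} : ℝ))]
  have hN : ((heightFamilyBelow X).card : ℝ) =
      (((heightFamilyBelow X).filter HasRationalTwoTorsion).card : ℝ) +
        (((heightFamilyBelow X).filter (fun AB : ℤ × ℤ ↦ ¬ HasRationalTwoTorsion AB)).card : ℝ) := by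
    exact_mod_cast (Finset.card_filter_add_card_filter_not
      (s := heightFamilyBelow X) HasRationalTwoTorsion).symm
  have hsum : (∑ AB ∈ (heightFamilyBelow X).filter (fun AB : ℤ × ℤ ↦ ¬ HasRationalTwoTorsion AB),
        (Nat.card ((shortWeierstrass AB).selmerGroup 2) : ℝ)) =
      (∑ AB ∈ (heightFamilyBelow X).filter (fun AB : ℤ × ℤ ↦ ¬ HasRationalTwoTorsion AB),
        (pgl2QClassCount {f : BinaryQuartic ℤ | f.IsLocallySoluble ∧
          f.IsIrreducible ∧ f.I = 2 ^ 4 * (-3 * AB.1) ∧ f.J = 2 ^ 6 * (-27 * AB.2)} : ℝ)) +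
        ((((heightFamilyBelow X).filter (fun AB : ℤ × ℤ ↦ ¬ HasRationalTwoTorsion AB))).card : ℝ) := by
    rw [Finset.card_eq_sum_ones, Nat.cast_sum, ← Finset.sum_add_distrib]
    refine Finset.sum_congr rfl fun AB hAB ↦ ?_
    rw [Finset.mem_filter, mem_heightFamilyBelow_iff] at hAB
    rw [card_selmerTwo_eq_succ h56 hAB.1.1 hAB.2]
    push_cast; ring
  rw [hN, hsum]
  ring

/-- **Bhargava–Shankar, Theorem 1.1, assembled from the printed intermediate results** (held arXiv
text §5.4): granted Lemma 5.15 (`card_heightFamilyBelow_asymptotic`: `N_X ~ c_F X^{5/6}`),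
eq. (31) evaluated by Prop. 5.12 and Lemma 5.16 (`bhargavaShankar_sum_irredClassCount_asymptotic`:
the classes of locally soluble irreducible quartics attached to the curves of height `< X` number
`2c_F X^{5/6} + o(X^{5/6})`), Theorem 5.6 (`bhargavaShankar_card_selmerTwo_eq`: `#S₂(E)` = number
of classes of locally soluble quartics with invariants `(2⁴I(E), 2⁶J(E))`) and Prop. 5.8
(`bhargavaShankar_sum_card_selmerTwo_twoTorsion_le`: Selmer elements of curves with rational
`2`-torsion total `O(X^{3/4+ε})`), the average of `#S₂(E)` over the curves of height `< X` tends
to `3` (`Literature.NumberTheory.EllipticCurves.average_card_selmerTwo`). Proved here: for curves without rational `2`-torsion,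
`#classes = #irreducible classes + 1` (`pgl2QClassCount_eq_succ`, the identity class); such
curves are all but `O(X^{1/2})` (Prop. 5.7, `card_filter_hasRationalTwoTorsion_le`); hence
`Σ #S₂(E) = Σ #irr + N_X + O(N_T + Σ_{2-torsion} #S₂) = 3c_F X^{5/6} + o(X^{5/6})`
(`sum_card_selmerTwo_eq`), and dividing by `N_X ~ c_F X^{5/6}` (`c_F > 0`,
`heightFamilyConstant_pos`) gives `3`.
[cite: BhargavaShankarAnnals2015, Thm 1.1 and §5.4 (arXiv:1006.1002v2 numbering)] -/
theorem average_card_selmerTwo_of_facts (h56 : bhargavaShankar_card_selmerTwo_eq)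
    (h515 : card_heightFamilyBelow_asymptotic)
    (h31 : bhargavaShankar_sum_irredClassCount_asymptotic)
    (h58 : bhargavaShankar_sum_card_selmerTwo_twoTorsion_le) : EllipticCurves.average_card_selmerTwo := by
  have hc := heightFamilyConstant_pos
  -- limits of the pieces, all divided by `X^{5/6}`
  have limN : Tendsto (fun X : ℕ ↦ ((heightFamilyBelow X).card : ℝ) / (X : ℝ) ^ (5 / 6 : ℝ))
      atTop (𝓝 heightFamilyConstant) := h515
  have limI : Tendsto (fun X : ℕ ↦ (∑ AB ∈ heightFamilyBelow X,
      (pgl2QClassCount {f : BinaryQuartic ℤ | f.IsLocallySoluble ∧ f.IsIrreducible ∧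
        f.I = 2 ^ 4 * (-3 * AB.1) ∧ f.J = 2 ^ 6 * (-27 * AB.2)} : ℝ)) / (X : ℝ) ^ (5 / 6 : ℝ))
      atTop (𝓝 (2 * heightFamilyConstant)) := h31
  have limNT : Tendsto (fun X : ℕ ↦ (((heightFamilyBelow X).filter HasRationalTwoTorsion).card : ℝ) /
      (X : ℝ) ^ (5 / 6 : ℝ)) atTop (𝓝 0) :=
    tendsto_div_rpow_fiveSixths_of_le (C := 15) (a := 1 / 2) (by norm_num)
      (fun X ↦ Nat.cast_nonneg _) (fun X _ ↦ card_filter_hasRationalTwoTorsion_le X)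
  obtain ⟨C, hC⟩ := h58 (1 / 24) (by norm_num)
  have limST : Tendsto (fun X : ℕ ↦ (∑ AB ∈ ((heightFamilyBelow X).filter HasRationalTwoTorsion),
      (Nat.card ((shortWeierstrass AB).selmerGroup 2) : ℝ)) / (X : ℝ) ^ (5 / 6 : ℝ)) atTop (𝓝 0) :=
    tendsto_div_rpow_fiveSixths_of_le (C := C) (a := 3 / 4 + 1 / 24) (by norm_num)
      (fun X ↦ Finset.sum_nonneg fun _ _ ↦ by positivity) (fun X _ ↦ hC X)
  have hITle : ∀ X : ℕ, (∑ AB ∈ (heightFamilyBelow X).filter HasRationalTwoTorsion,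
      (pgl2QClassCount {f : BinaryQuartic ℤ |
        f.IsLocallySoluble ∧ f.IsIrreducible ∧ f.I = 2 ^ 4 * (-3 * AB.1) ∧
          f.J = 2 ^ 6 * (-27 * AB.2)} : ℝ)) ≤
      ∑ AB ∈ (heightFamilyBelow X).filter HasRationalTwoTorsion,
        (Nat.card ((shortWeierstrass AB).selmerGroup 2) : ℝ) := by
    intro X
    refine Finset.sum_le_sum fun AB hAB ↦ ?_
    simp only [Finset.mem_filter, mem_heightFamilyBelow_iff] at hAB
    exact_mod_cast irredClassCount_le_card_selmerTwo h56 hAB.1.1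
  have limIT : Tendsto (fun X : ℕ ↦ (∑ AB ∈ (heightFamilyBelow X).filter HasRationalTwoTorsion,
      (pgl2QClassCount {f : BinaryQuartic ℤ |
        f.IsLocallySoluble ∧ f.IsIrreducible ∧ f.I = 2 ^ 4 * (-3 * AB.1) ∧
          f.J = 2 ^ 6 * (-27 * AB.2)} : ℝ)) / (X : ℝ) ^ (5 / 6 : ℝ)) atTop (𝓝 0) :=
    tendsto_of_tendsto_of_tendsto_of_le_of_le' tendsto_const_nhds limST
      (Eventually.of_forall fun X ↦
        div_nonneg (Finset.sum_nonneg fun _ _ ↦ by positivity) (by positivity))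
      (Eventually.of_forall fun X ↦ div_le_div_of_nonneg_right (hITle X) (by positivity))
  have limS : Tendsto (fun X : ℕ ↦ (∑ AB ∈ heightFamilyBelow X,
      (Nat.card ((shortWeierstrass AB).selmerGroup 2) : ℝ)) / (X : ℝ) ^ (5 / 6 : ℝ))
      atTop (𝓝 (3 * heightFamilyConstant)) := by
    have h := ((limI.sub limIT).add (limN.sub limNT)).add limST
    have e : 2 * heightFamilyConstant - 0 + (heightFamilyConstant - 0) + 0 =
        3 * heightFamilyConstant := by ring
    rw [e] at h
    refine h.congr fun X ↦ ?_
    rw [sum_card_selmerTwo_eq h56 X]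
    ring
  -- conclusion
  have key : Tendsto (fun X : ℕ ↦ ((∑ AB ∈ heightFamilyBelow X,
      (Nat.card ((shortWeierstrass AB).selmerGroup 2) : ℝ)) / (X : ℝ) ^ (5 / 6 : ℝ)) /
      (((heightFamilyBelow X).card : ℝ) / (X : ℝ) ^ (5 / 6 : ℝ))) atTop (𝓝 3) := by
    have := limS.div limN hc.ne'
    rwa [show 3 * heightFamilyConstant / heightFamilyConstant = 3 by field_simp] at this
  unfold EllipticCurves.average_card_selmerTwo heightAverage
  refine key.congr' ?_
  filter_upwards [eventually_ge_atTop 1] with X hX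
  have hP0 : (X : ℝ) ^ (5 / 6 : ℝ) ≠ 0 := (Real.rpow_pos_of_pos (by exact_mod_cast hX) _).ne'
  rw [div_div_div_cancel_right₀ hP0]

/-- **Bhargava–Shankar, Theorem 1.1 in `limsup` form, from the same printed inputs**
(`Literature.NumberTheory.EllipticCurves.heightAverageLE_card_selmerTwo`). [cite: BhargavaShankarAnnals2015, Thm 1.1] -/
theorem heightAverageLE_card_selmerTwo_of_facts (h56 : bhargavaShankar_card_selmerTwo_eq)
    (h515 : card_heightFamilyBelow_asymptotic)
    (h31 : bhargavaShankar_sum_irredClassCount_asymptotic)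
    (h58 : bhargavaShankar_sum_card_selmerTwo_twoTorsion_le) : EllipticCurves.heightAverageLE_card_selmerTwo :=
  HeightAverageLE.of_tendsto (EllipticCurves.average_card_selmerTwo_of_facts h56 h515 h31 h58)

/-- **Bhargava–Shankar, Cor. 1.2 from the printed inputs of Theorem 1.1**: granted Lemma 5.15,
eq. (31) (with Prop. 5.12 and Lemma 5.16), Theorem 5.6 and Prop. 5.8 of the held arXiv text, the
average rank of elliptic curves over `ℚ` ordered by naive height is at most `3/2`
(`Literature.NumberTheory.EllipticCurves.averageRankLE_three_halves`): Theorem 1.1 assembled here, then Cor. 1.2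
(`averageRankLE_three_halves_of_facts`, file `BSDWave0Proofs`, with AEC X.4.2(b) supplied by
`finite_selmerGroup_holds`). [cite: BhargavaShankarAnnals2015, Cor. 1.2] -/
theorem averageRankLE_three_halves_of_counting_facts
    (h56 : bhargavaShankar_card_selmerTwo_eq) (h515 : card_heightFamilyBelow_asymptotic)
    (h31 : bhargavaShankar_sum_irredClassCount_asymptotic)
    (h58 : bhargavaShankar_sum_card_selmerTwo_twoTorsion_le) : EllipticCurves.averageRankLE_three_halves :=
  EllipticCurves.averageRankLE_three_halves_of_facts
    (EllipticCurves.heightAverageLE_card_selmerTwo_of_facts h56 h515 h31 h58)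
    fun W ↦ W.finite_selmerGroup_holds

end Assembly

/-! ## Lemma 5.16 (Brumer–Kramer) from Silverman AEC VII.6.3 -/

/-! ## Herbrand-quotient algebra for multiplication by `n` -/

section Herbrand

variable {G : Type*} [AddCommGroup G]

/-- The kernel of multiplication by `n` is the `n`-torsion subgroup. [folklore] -/
theorem ker_zsmulAddGroupHom (n : ℤ) :
    (zsmulAddGroupHom (α := G) n).ker = AddSubgroup.torsionBy G n := by
  ext x
  simp [AddMonoidHom.mem_ker, Submodule.mem_torsionBy_iff]

/-- Multiplication by `n` maps a subgroup into itself. [folklore] -/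
theorem map_zsmulAddGroupHom_le (A : AddSubgroup G) (n : ℤ) :
    A.map (zsmulAddGroupHom (α := G) n) ≤ A := by
  rintro _ ⟨a, ha, rfl⟩
  exact A.zsmul_mem ha n

/-- **Index calculus for multiplication by `n`** (the Herbrand-quotient identity behind
Brumer–Kramer's lemma): for a finite-index subgroup `A ≤ G` of an abelian group and `f = n·`,
`[G : nG] · #(A ∩ G[n]) = [A : nA] · #G[n]` (indices and cardinalities as natural numbers, with
Mathlib's conventions `0` for infinite ones). Proof: `[G : nA] = [G : A + G[n]]·[G : nG]`
(`AddSubgroup.index_map`), `[G : nA] = [G : A]·[A : nA]`, `[G : A] = [G : A + G[n]]·[G[n] : A ∩ G[n]]`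
and `#G[n] = [G[n] : A ∩ G[n]]·#(A ∩ G[n])`. [folklore] -/
theorem index_range_zsmul_mul_card (A : AddSubgroup G) [A.FiniteIndex] (n : ℤ) :
    (zsmulAddGroupHom (α := G) n).range.index *
        Nat.card (A ⊓ (zsmulAddGroupHom (α := G) n).ker : AddSubgroup G) =
      (A.map (zsmulAddGroupHom (α := G) n)).relIndex A *
        Nat.card (zsmulAddGroupHom (α := G) n).ker := by
  set f := zsmulAddGroupHom (α := G) n with hf
  have hle1 : A.map f ≤ A := map_zsmulAddGroupHom_le A n
  have hle2 : A ≤ A ⊔ f.ker := le_sup_left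
  have h1 : (A.map f).index = (A ⊔ f.ker).index * f.range.index := A.index_map f
  have h2 : (A.map f).relIndex A * A.index = (A.map f).index := AddSubgroup.relIndex_mul_index hle1
  have h3 : A.relIndex (A ⊔ f.ker) * (A ⊔ f.ker).index = A.index :=
    AddSubgroup.relIndex_mul_index hle2
  have h4 : A.relIndex (A ⊔ f.ker) = A.relIndex f.ker := AddSubgroup.relIndex_sup_left _ _
  have h5 : Nat.card (A.addSubgroupOf f.ker) * A.relIndex f.ker = Nat.card f.ker :=
    AddSubgroup.card_mul_index _
  have h6 : Nat.card (A.addSubgroupOf f.ker) = Nat.card (A ⊓ f.ker : AddSubgroup G) := by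
    rw [← AddSubgroup.addSubgroupOf_map_subtype]
    exact Nat.card_congr ((A.addSubgroupOf f.ker).equivMapOfInjective f.ker.subtype
      Subtype.val_injective).toEquiv
  haveI : (A ⊔ f.ker).FiniteIndex := AddSubgroup.finiteIndex_of_le hle2
  have hs : (A ⊔ f.ker).index ≠ 0 := AddSubgroup.FiniteIndex.index_ne_zero
  -- `[A : nA] · [G[n] : A ∩ G[n]] = [G : nG]`
  have key : (A.map f).relIndex A * A.relIndex f.ker = f.range.index := by
    apply Nat.eq_of_mul_eq_mul_left (Nat.pos_of_ne_zero hs)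
    calc (A ⊔ f.ker).index * ((A.map f).relIndex A * A.relIndex f.ker)
        = (A.map f).relIndex A * (A.relIndex (A ⊔ f.ker) * (A ⊔ f.ker).index) := by rw [h4]; ring
      _ = (A.map f).relIndex A * A.index := by rw [h3]
      _ = (A ⊔ f.ker).index * f.range.index := by rw [h2, h1]
  calc f.range.index * Nat.card (A ⊓ f.ker : AddSubgroup G)
      = (A.map f).relIndex A * (Nat.card (A.addSubgroupOf f.ker) * A.relIndex f.ker) := by
        rw [← key, h6]; ring
    _ = (A.map f).relIndex A * Nat.card f.ker := by rw [h5]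

/-- The relative index `[A : nA]` is the index of multiplication by `n` on `A` itself. [folklore] -/
theorem relIndex_map_zsmul (A : AddSubgroup G) (n : ℤ) :
    (A.map (zsmulAddGroupHom (α := G) n)).relIndex A =
      (zsmulAddGroupHom (α := A) n).range.index := by
  rw [AddSubgroup.relIndex]
  congr 1
  ext ⟨x, hx⟩
  simp only [AddSubgroup.mem_addSubgroupOf, AddSubgroup.mem_map, AddMonoidHom.mem_range,
    zsmulAddGroupHom_apply]
  constructor
  · rintro ⟨a, ha, hax⟩
    exact ⟨⟨a, ha⟩, Subtype.ext (by simpa using hax)⟩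
  · rintro ⟨⟨a, ha⟩, hax⟩
    exact ⟨a, ha, by simpa using congrArg Subtype.val hax⟩

/-- Transport of `[A : nA]` along an isomorphism. [folklore] -/
theorem index_range_zsmul_congr {H : Type*} [AddCommGroup H] (e : G ≃+ H) (n : ℤ) :
    (zsmulAddGroupHom (α := G) n).range.index = (zsmulAddGroupHom (α := H) n).range.index := by
  have hmap : (zsmulAddGroupHom (α := G) n).range.map (e : G →+ H) =
      (zsmulAddGroupHom (α := H) n).range := by
    ext y
    simp only [AddSubgroup.mem_map, AddMonoidHom.mem_range, zsmulAddGroupHom_apply,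
      AddMonoidHom.coe_coe]
    constructor
    · rintro ⟨x, ⟨g, rfl⟩, rfl⟩
      exact ⟨e g, by simp⟩
    · rintro ⟨h, rfl⟩
      exact ⟨n • e.symm h, ⟨e.symm h, rfl⟩, by simp⟩
  rw [AddSubgroup.index, AddSubgroup.index]
  exact Nat.card_congr (QuotientAddGroup.congr _ _ e hmap).toEquiv

end Herbrand

/-! ## `ℤ_p / 2ℤ_p` and `ℤ_p[2]` -/

section PadicInt

variable (p : ℕ) [Fact p.Prime]

/-- `ℤ_p` has no `n`-torsion for `n ≠ 0`. [folklore] -/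
theorem torsionBy_padicInt_eq_bot {n : ℤ} (hn : n ≠ 0) : AddSubgroup.torsionBy ℤ_[p] n = ⊥ := by
  rw [eq_bot_iff]
  intro x hx
  rw [Submodule.mem_toAddSubgroup, Submodule.mem_torsionBy_iff, zsmul_eq_mul, mul_eq_zero] at hx
  rcases hx with h | h
  · exact absurd h (Int.cast_ne_zero.mpr hn)
  · exact h

/-- The range of multiplication by `2` on `ℤ_p` is the ideal `(2)`. [folklore] -/
theorem range_zsmul_two_padicInt :
    (zsmulAddGroupHom (α := ℤ_[p]) 2).range = (Ideal.span {(2 : ℤ_[p])}).toAddSubgroup := by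
  ext x
  simp only [AddMonoidHom.mem_range, zsmulAddGroupHom_apply, Submodule.mem_toAddSubgroup,
    Ideal.mem_span_singleton']
  constructor
  · rintro ⟨y, rfl⟩; exact ⟨y, by rw [zsmul_eq_mul, mul_comm]; norm_num⟩
  · rintro ⟨y, rfl⟩; exact ⟨y, by rw [zsmul_eq_mul, mul_comm]; norm_num⟩

/-- `[ℤ_2 : 2ℤ_2] = 2`. [folklore] -/
theorem index_range_zsmul_two_padicInt_two :
    (zsmulAddGroupHom (α := ℤ_[2]) 2).range.index = 2 := by
  have hker : (zsmulAddGroupHom (α := ℤ_[2]) 2).range =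
      (PadicInt.toZMod : ℤ_[2] →+* ZMod 2).toAddMonoidHom.ker := by
    rw [range_zsmul_two_padicInt]
    ext x
    rw [Submodule.mem_toAddSubgroup, AddMonoidHom.mem_ker, RingHom.toAddMonoidHom_eq_coe,
      AddMonoidHom.coe_coe, ← RingHom.mem_ker, PadicInt.ker_toZMod,
      PadicInt.maximalIdeal_eq_span_p, Nat.cast_ofNat]
  rw [hker, AddSubgroup.index]
  have e := QuotientAddGroup.quotientKerEquivOfSurjective
    (PadicInt.toZMod : ℤ_[2] →+* ZMod 2).toAddMonoidHom (ZMod.ringHom_surjective PadicInt.toZMod)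
  rw [Nat.card_congr e.toEquiv, Nat.card_zmod]

/-- `[ℤ_p : 2ℤ_p] = 1` for odd `p`. [folklore] -/
theorem index_range_zsmul_two_padicInt_odd (hp : p ≠ 2) :
    (zsmulAddGroupHom (α := ℤ_[p]) 2).range.index = 1 := by
  rw [AddSubgroup.index_eq_one, eq_top_iff]
  intro x _
  have hu : IsUnit (2 : ℤ_[p]) := by
    rw [PadicInt.isUnit_iff]
    have h1 : ‖((2 : ℤ) : ℤ_[p])‖ ≤ 1 := PadicInt.norm_le_one _
    have h2 : ¬ ‖((2 : ℤ) : ℤ_[p])‖ < 1 := by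
      rw [PadicInt.norm_int_lt_one_iff_dvd]
      intro h
      have : (p : ℤ) ∣ 2 := h
      have hp2 : p ∣ 2 := by exact_mod_cast this
      have := (Nat.prime_dvd_prime_iff_eq (Fact.out) Nat.prime_two).mp hp2
      exact hp this
    push_cast at h1 h2
    exact le_antisymm h1 (not_lt.mp h2)
  obtain ⟨u, hu⟩ := hu
  refine ⟨↑u⁻¹ * x, ?_⟩
  rw [zsmulAddGroupHom_apply, zsmul_eq_mul, Int.cast_ofNat, ← hu, ← mul_assoc, Units.mul_inv,
    one_mul]

end PadicInt

/-! ## Brumer–Kramer from AEC VII.6.3 -/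

/-- **Brumer–Kramer's lemma from Silverman AEC VII.6.3** (Bhargava–Shankar, Lemma 5.16):
granted that `E(ℚ_p)` contains a finite-index subgroup isomorphic to `ℤ_p`
(`exists_finiteIndex_addEquiv_padicInt`), `#E(ℚ_p)/2E(ℚ_p) = c_p · #E(ℚ_p)[2]`
with `c₂ = 2` and `c_p = 1` for odd `p`: the Herbrand-quotient identity
`[G : 2G]·#(A ∩ G[2]) = [A : 2A]·#G[2]` (`index_range_zsmul_mul_card`) with `A ≅ ℤ_p`,
`[ℤ_p : 2ℤ_p] = |2|_p⁻¹`, `ℤ_p[2] = 0`. [cite: BhargavaShankarAnnals2015, Lemma 5.16 (arXiv:1006.1002v2 numbering)] -/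
theorem brumerKramer_card_quotient_two_of_AEC
    (h : exists_finiteIndex_addEquiv_padicInt) :
    brumerKramer_card_quotient_two := by
  intro p _ W _
  obtain ⟨A, hA, ⟨e⟩⟩ := h p W
  haveI := hA
  set G := W.toAffine.Point
  set f := zsmulAddGroupHom (α := G) 2 with hf
  have key := index_range_zsmul_mul_card A 2
  -- `A ∩ G[2] = 0`
  have hinf : (A ⊓ f.ker : AddSubgroup G) = ⊥ := by
    rw [eq_bot_iff]
    rintro x ⟨hxA, hxk⟩
    rw [AddSubgroup.mem_bot]
    have hx2 : (2 : ℤ) • (⟨x, hxA⟩ : A) = 0 := by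
      apply Subtype.ext
      simpa [hf, AddMonoidHom.mem_ker] using hxk
    have : (2 : ℤ) • e ⟨x, hxA⟩ = 0 := by rw [← map_zsmul, hx2, map_zero]
    rw [zsmul_eq_mul, mul_eq_zero] at this
    rcases this with h2 | h0
    · norm_num at h2
    · have : (⟨x, hxA⟩ : A) = 0 := e.injective (by rw [h0, map_zero])
      exact congrArg Subtype.val this
  have hcard1 : Nat.card (A ⊓ f.ker : AddSubgroup G) = 1 := by
    rw [hinf]; exact Nat.card_unique
  -- `[A : 2A] = [ℤ_p : 2ℤ_p]`
  have hrel : (A.map f).relIndex A = (if p = 2 then 2 else 1) := by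
    rw [relIndex_map_zsmul, index_range_zsmul_congr e 2]
    split_ifs with hp
    · subst hp; exact index_range_zsmul_two_padicInt_two
    · exact index_range_zsmul_two_padicInt_odd p hp
  rw [hcard1, mul_one, hrel, ker_zsmulAddGroupHom] at key
  rw [← key]
  rfl

/-! ## Theorem 1.1 and Cor. 1.2 granted the three deep printed inputs -/

section Final

/-- **Bhargava–Shankar, Theorem 1.1, granted Thm 5.6, eq. (31) (with Prop. 5.12, Lemma 5.16) and
Prop. 5.8 of the held arXiv text** — Lemma 5.15 being proved
(`card_heightFamilyBelow_asymptotic_holds`): the average size of the `2`-Selmer group over the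
curves of naive height `< X` tends to `3` (`Literature.NumberTheory.EllipticCurves.average_card_selmerTwo`).
[cite: BhargavaShankarAnnals2015, Thm 1.1 (arXiv:1006.1002v2 numbering)] -/
theorem average_card_selmerTwo_of_BS_facts (h56 : bhargavaShankar_card_selmerTwo_eq)
    (h31 : bhargavaShankar_sum_irredClassCount_asymptotic)
    (h58 : bhargavaShankar_sum_card_selmerTwo_twoTorsion_le) : EllipticCurves.average_card_selmerTwo :=
  EllipticCurves.average_card_selmerTwo_of_facts h56 card_heightFamilyBelow_asymptotic_holds h31 h58

/-- **Bhargava–Shankar, Theorem 1.1 in `limsup` form, granted the same three inputs**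
(`Literature.NumberTheory.EllipticCurves.heightAverageLE_card_selmerTwo`). [cite: BhargavaShankarAnnals2015, Thm 1.1] -/
theorem heightAverageLE_card_selmerTwo_of_BS_facts (h56 : bhargavaShankar_card_selmerTwo_eq)
    (h31 : bhargavaShankar_sum_irredClassCount_asymptotic)
    (h58 : bhargavaShankar_sum_card_selmerTwo_twoTorsion_le) : EllipticCurves.heightAverageLE_card_selmerTwo :=
  HeightAverageLE.of_tendsto (EllipticCurves.average_card_selmerTwo_of_BS_facts h56 h31 h58)

/-- **Bhargava–Shankar, Cor. 1.2 (`Literature.NumberTheory.EllipticCurves.averageRankLE_three_halves`), granted exactly the three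
deep printed inputs of Theorem 1.1**: the `2`-Selmer parametrization Thm 5.6
(`bhargavaShankar_card_selmerTwo_eq`), the count of classes of locally soluble irreducible quartics
eq. (31) with Prop. 5.12 and Lemma 5.16 (`bhargavaShankar_sum_irredClassCount_asymptotic`), and
Prop. 5.8 (`bhargavaShankar_sum_card_selmerTwo_twoTorsion_le`). Everything downstream — Lemma 5.15,
Prop. 5.7, the identity class, the §5.4 bookkeeping, Cor. 1.2 from Thm 1.1 and AEC X.4.2(b) — is
proved in the tree. [cite: BhargavaShankarAnnals2015, Cor. 1.2] -/
theorem averageRankLE_three_halves_of_BS_facts (h56 : bhargavaShankar_card_selmerTwo_eq)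
    (h31 : bhargavaShankar_sum_irredClassCount_asymptotic)
    (h58 : bhargavaShankar_sum_card_selmerTwo_twoTorsion_le) : EllipticCurves.averageRankLE_three_halves :=
  EllipticCurves.averageRankLE_three_halves_of_facts
    (EllipticCurves.heightAverageLE_card_selmerTwo_of_BS_facts h56 h31 h58)
    fun W ↦ W.finite_selmerGroup_holds

end Final

end Literature.NumberTheory.EllipticCurves

end
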